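import Literature.Geometry.Kaehler.ComplexTorusHodgeLieAlgebraRatProductHomIntertwiners
import Literature.Geometry.Kaehler.ComplexTorusHodgeGroupProductHodgeGeneralFactor
import Literature.Geometry.Kaehler.ComplexTorusHodgeGroupProductCMEllipticCurveCenterEmbedding
import Literature.Geometry.Kaehler.ComplexTorusLieAlgebraIdealsDefinedOverQ
import Literature.Geometry.Kaehler.ComplexTorusHodgeLieAlgebraRatReductive
import Literature.Geometry.Kaehler.ComplexTorusEllipticCurveHodgeLieAlgebraRat
import Literature.Geometry.Kaehler.ComplexTorusHodgeLieAlgebraHodgeTypes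
import Literature.Algebra.Lie.Sl2TripleComplexStructureWeights
import Literature.Algebra.Lie.ReductiveIdealsQuotients
import HarnessLib

/-!
# Moonen–Zarhin (3.8), the non-CM half: `Hom(E, X) = 0`, `End(E) = ℤ` ⟹ `Hg(X × E)(ℂ) = Hg(X)(ℂ) × Hg(E)(ℂ)`

Layer `Literature/Geometry/Kaehler`, namespace `Literature.Geometry.Kaehler.ComplexTorus`; lane `lit-hodgefound` (Track 2
foundations library), Layer A4; prover seat `lit-hodgefound-p17` (generation 45, self-proposed row g45-#2).  THEOREMS ONLY (no
definition, no instance, no notation, no named fact; D-0026 net debt 0).  The commutator Lie structure on matrices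
(`LieRing.ofAssociativeRing`, not a global instance) enters only through the tree's `hodgeGroupLieRat` and `letI` inside proofs.

## Source, verbatim

B. Moonen, Yu. G. Zarhin [MoonenZarhin1999LowDim], *Hodge classes on abelian varieties of low dimension*, Math. Ann. 315
(1999), §3 (held `paper:arxiv-math_9901113`):
* PROPOSITION (3.8) (p0007 L55–L63): «Let `X` be an abelian variety and let `E` be an elliptic curve, both over `ℂ`. Suppose
  `Hom(E, X) = 0`. Then either `Hg(X × E) = Hg(X) × Hg(E)` or `End⁰(E) = k` is an imaginary quadratic field such that there
  exists an embedding of `k` into the center of `End⁰(X)`.» Proof, first line: «If `End⁰(E) = ℚ` then we apply Lemma (3.4).»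
* LEMMA (3.4) (p0006 L133–p0007 L7): «Assume that `𝔥𝔤(X₂)` is a `ℚ`-simple Lie algebra of non-compact type and that, up to
  isomorphism, `V_{X₂}` is the only irreducible `𝔥𝔤(X₂)`-module which is a length 1 representation of non-compact type. Then
  either `Hg(X) = Hg(X₁) × Hg(X₂)` or `Hom(X₂, X₁) ≠ 0`.» (proof: «the assumption that `𝔥𝔤(X₂)` is `ℚ`-simple implies that
  `𝔥𝔤(X) = 𝔤₁ ⊕ 𝔤₃ ≅ 𝔥𝔤(X₁)` and `𝔥𝔤(X₂) ≅ 𝔤₃`» + Lemma (3.3)).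
* LEMMA (3.3), proof (p0006 L100–L129): «on each of the summands `U_j^d` the operator `J_X` has `+i` and `-i` as its
  eigenvalues … both `i + λ` and `-i + λ` occur as eigenvalues of `J_Y` … this is possible only if `λ = 0`. We conclude that
  `J₂` acts trivially … The graph `Γ_φ ⊂ 𝔥𝔤(X) × 𝔥𝔤(Y)` is a `ℚ`-Lie subalgebra such that `Γ_{φ,ℂ} ∋ J_{X×Y} = (J_X, J_Y)`.
  Therefore `𝔥𝔤(X × Y) = Γ_φ` and some multiple of `φ` corresponds to an isogeny from `X` to `Y`.»
* (3.1) (p0006 L25–L60): «`𝔥𝔤(X₁ × X₂) ≅ 𝔤₁ ⊕ 𝔤₂ ⊕ Γ_φ` … We may have that `Hg(X₁ × X₂) ≠ Hg(X₁) × Hg(X₂)` … In certain cases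
  one can show that an inequality (1) can only hold if `Hom(X₁, X₂) ≠ 0`.»
Also: H. Lange [Lange2023AbelianVarietiesComplex], §7.2.2 Prop. 7.2.5 / §7.2.4 Exercise (3) («`End_ℚ(X) = End_{Hg(X)}(H₁(X, ℚ))`»)
and §1.1.2 Prop. 1.1.6 (an endomorphism is a rational matrix commuting with the complex structure `J`).

## The road taken here (torus level, over `ℚ`; `X = E₁/Φ₁(ℤ^{ι₁})` polarised, `E_τ = ℂ/(ℤ + τℤ)` with `End(E_τ) = ℤ`)

Write `𝒜(·) = hodgeGroupLieRat` (the `ℚ`-Lie algebra of the Hodge group), `𝒫 = 𝒜(X × E_τ)`, `𝒜(E_τ) = 𝔰𝔩₂(ℚ)`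
(`hodgeGroupLieRat_ellipticPeriod_eq_sl_of_eq_bot`), and suppose `Hg(X × E_τ)(ℂ) ≠ Hg(X)(ℂ) × Hg(E_τ)(ℂ)`.
* §1 «`𝔥𝔤(X × E) = 𝔤₁ ⊕ Γ_φ`»: the block projection `r₁ : 𝒫 → 𝒜(X)` is bijective (`𝒜(E_τ)` is `ℚ`-simple, Goursat), so `𝒫` is the
  GRAPH of `q = r₂ ∘ r₁⁻¹ : 𝒜(X) ↠ 𝔰𝔩₂(ℚ)`; `𝒜(X) = ker q ⊕ 𝔰` for an ideal `𝔰 ≅ 𝔰𝔩₂(ℚ)` (`𝒜(X)` is reductive, Bourbaki I §6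
  no. 4), carrying a rational `𝔰𝔩₂`-triple `(h, e, f) = q|_𝔰⁻¹(H, E, F)`; `ker q = {A ∈ 𝒜(X) | (A 0; 0 0) ∈ 𝒫}` commutes with
  `h, e, f` — `exists_sl2Triple_hodgeGroupLieRat_of_hodgeGroupC_prod_ellipticPeriod_ne`.
* §2 «`Γ_{φ,ℂ} ∋ (J_X, J_E)`» and «only `λ = 0`»: `J ⊗ 1 ∈ 𝒜(X) ⊗ ℂ` splits as `J_I + x`, `J_I ∈ (ker q) ⊗ ℂ`,
  `x = α h + β e + γ f`; `(ad J)³ = -4 ad J` forces `α² + βγ = -1` (else `J` commutes with `𝔰`, so `𝔰 ⊆ End⁰(X)` is abelian);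
  the `𝔰𝔩₂`-weights lemma of `Literature/Algebra/Lie/Sl2TripleComplexStructureWeights` (MZ's eigenvalue count, for the triple
  through `-i x`) then yields the STANDARD-ISOTYPIC IDENTITIES over `ℚ`: `e² = f² = 0`, `h e = e = -e h`, `h f = -f = -f h`,
  `e f + f e = h² =: P`, `h P = h`, and `J P = P J = x`, `J_I h = 0`.
* §3 «`J₂` acts trivially» ⟹ `ker q` kills `𝔰 · V = Im P`: every rational `c = P c P` commuting with `𝔰` commutes with `J`, hence
  lies in `End⁰(X)` (Lange 1.1.6) and commutes with `𝒜(X)` (Lange 7.2.5 over `ℚ`, the tree's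
  `mul_comm_of_mem_hodgeGroupLieRat_of_mem_endAlgRat`); a matrix-unit argument then makes `A P` a scalar multiple `λ P` for
  `A ∈ ker q`, and `𝒜(X) ⊆ 𝔰𝔭(V, E)` (`transpose_mul_eq_neg_mul_of_mem_hodgeGroupLieRat`) gives `λ = 0`.  (This replaces the
  passage through a simple abelian subvariety `Y ⊂ X₁` in the printed proof of (3.4).)
* §4 «some multiple of `φ` corresponds to an isogeny»: with `v = e u ≠ 0` a primitive weight-one vector, the `|ι₁| × 2` matrix
  `[v | f v]` intertwines `𝒫` (`Hom_ℚ = intertwiners`, `mem_homRat_iff_forall_mul_toBlocks₂₂_eq_toBlocks₁₁_mul`), so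
  `Hom_ℚ(E_τ, X) ≠ 0` — **`IsRiemannForm.homRat_ellipticPeriod_ne_bot_of_hodgeGroupC_prod_ne`**; contrapositive
  **`IsRiemannForm.hodgeGroupC_prod_ellipticPeriod_eq_blockDiagProd_of_homRat_eq_bot`** (MZ (3.8), `End(E) = ℤ`), with the
  `IsAbelianVariety` and real-points (`hodgeGroup_prod_ellipticPeriod_eq_of_homRat_eq_bot`) forms; joined with the CM half
  (`ComplexTorusHodgeGroupProductCMEllipticCurveCenterEmbedding`) into PROPOSITION (3.8) AS PRINTED:
  **`IsRiemannForm.hodgeGroupC_prod_ellipticPeriod_eq_blockDiagProd_or_of_homRat_eq_bot`** (`Hom(E, X) = 0` ⟹ the Hodge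
  group of `X × E` is the product, or `E` has CM by `k = ℚ(τ)` and `k` embeds into the centre of `End⁰(X)`).
* §5 THE DICHOTOMY for a non-CM elliptic factor: `Hg(X × E_τ) = Hg(X) × Hg(E_τ)` ⟺ `Hom_ℚ(E_τ, X) = 0` ⟺ `Hom_ℚ(X, E_τ) = 0`
  (complex and real points; «⟹» is the tree's `homRat_swap_eq_bot_of_hodgeGroup_prodPeriod_eq_map_blockDiag`, any two tori)
  — `IsRiemannForm.hodgeGroupC_prod_ellipticPeriod_eq_blockDiagProd_iff_homRat_eq_bot` and companions.

## References

* [MoonenZarhin1999LowDim] B. Moonen, Yu. G. Zarhin, Math. Ann. 315 (1999) 711–733, §3 (3.1), Lemma (3.3), Lemma (3.4), Prop. (3.8) (arXiv v2 = Math. Ann. numbering: Lemma (3.3) = chunk p0006 L84–L131, Lemma (3.4) = p0006 L133–p0007 L7; earlier tree copies of this family wrote «(3.4)»∕«(3.5)» for these two lemmas).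
* [Lange2023AbelianVarietiesComplex] H. Lange, *Abelian Varieties over the Complex Numbers* (2023), §1.1.2 Prop. 1.1.6, §7.2.2
  Prop. 7.2.5, §7.2.4 Exercise (3).
* [Gordon1997] B. B. Gordon, *A survey of the Hodge conjecture for abelian varieties*, §2.16 Proposition (Goursat).
* [Bourbaki1989LieGroups13] N. Bourbaki, *Lie Groups and Lie Algebras, Ch. 1–3*, I §6 no. 4 Cor. (b) of Prop. 5.
* [Imai1976HodgeGroups] H. Imai, Kōdai Math. Sem. Rep. 27 (1976), §2 Proposition (`Hg(E) = SL₂` for `E` without CM), §3 Remarks.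
* [HulekLaface2019PicardNumbersAV] K. Hulek, R. Laface, *On the Picard numbers of abelian varieties* (2019), §2.1 Prop. 2.2
  (`rk Hom(X₁, X₂) = rk Hom(X₂, X₁)`).
-/

noncomputable section

open Matrix Module Function

namespace Literature.Geometry.Kaehler

namespace ComplexTorus

open Literature.NumberTheory.Automorphic (lieSubalgebraGL)
open Literature.Algebra.Lie

/-! ### §0 Matrix lemmas -/

section MatrixLemmas

variable {K : Type*} [Field K] {n : Type*} [Fintype n] [DecidableEq n]

/-- `(M E_{kl} N)_{ij} = M_{ik} N_{lj}`. [folklore] -/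
private theorem mul_single_mul_apply₄₅ (M N : Matrix n n K) (k l i j : n) :
    (M * Matrix.single k l (1 : K) * N) i j = M i k * N l j := by
  rw [Matrix.mul_assoc, Matrix.mul_apply, Finset.sum_eq_single k]
  · rw [Matrix.single_mul_apply_same, one_mul]
  · intro b _ hb
    rw [Matrix.single_mul_apply_of_ne (1 : K) k l b j hb N, mul_zero]
  · intro h; exact absurd (Finset.mem_univ k) h

/-- **Matrix units detect scalars**: if `T (Q E Q) = (Q E Q) T` for every matrix unit `E` and `Q ≠ 0`, then `T Q = λ Q`.
[folklore] -/
private theorem exists_mul_eq_smul_of_forall_single₄₅ {T Q : Matrix n n K} (hQ : Q ≠ 0)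
    (h : ∀ k l : n, T * (Q * Matrix.single k l (1 : K) * Q) = Q * Matrix.single k l (1 : K) * Q * T) :
    ∃ c : K, T * Q = c • Q := by
  obtain ⟨a, b, hab⟩ : ∃ a b, Q a b ≠ 0 := by
    by_contra hall
    exact hQ (Matrix.ext fun a b ↦ by
      have h1 := not_exists.1 hall a
      rw [not_exists] at h1
      simpa using h1 b)
  refine ⟨(Q * T) a b / Q a b, Matrix.ext fun i k ↦ ?_⟩
  have h1 := congrFun (congrFun (h k a) i) b
  rw [← Matrix.mul_assoc T, ← Matrix.mul_assoc T Q, Matrix.mul_assoc (Q * Matrix.single k a 1) Q T,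
    mul_single_mul_apply₄₅, mul_single_mul_apply₄₅] at h1
  rw [Matrix.smul_apply, smul_eq_mul, div_mul_eq_mul_div, eq_div_iff hab, h1, mul_comm]

end MatrixLemmas

section CastLemmas

variable {m : Type*}

/-- `(M N) ⊗ 1 = (M ⊗ 1)(N ⊗ 1)` over `ℚ ⊂ ℂ`. [folklore] -/
private theorem map_ratCast_mul₄₅ [Fintype m] (M N : Matrix m m ℚ) :
    (M * N).map ((↑) : ℚ → ℂ) = M.map ((↑) : ℚ → ℂ) * N.map ((↑) : ℚ → ℂ) :=
  Matrix.map_mul (f := Rat.castHom ℂ)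

/-- `(M + N) ⊗ 1 = M ⊗ 1 + N ⊗ 1`. [folklore] -/
private theorem map_ratCast_add₄₅ (M N : Matrix m m ℚ) :
    (M + N).map ((↑) : ℚ → ℂ) = M.map ((↑) : ℚ → ℂ) + N.map ((↑) : ℚ → ℂ) :=
  Matrix.map_add _ Rat.cast_add M N

/-- `(M - N) ⊗ 1 = M ⊗ 1 - N ⊗ 1`. [folklore] -/
private theorem map_ratCast_sub₄₅ (M N : Matrix m m ℚ) :
    (M - N).map ((↑) : ℚ → ℂ) = M.map ((↑) : ℚ → ℂ) - N.map ((↑) : ℚ → ℂ) :=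
  Matrix.map_sub _ Rat.cast_sub M N

/-- `(a M) ⊗ 1 = a (M ⊗ 1)`. [folklore] -/
private theorem map_ratCast_smul₄₅ (a : ℚ) (M : Matrix m m ℚ) :
    (a • M).map ((↑) : ℚ → ℂ) = (a : ℂ) • M.map ((↑) : ℚ → ℂ) := by
  ext i j; simp only [Matrix.map_apply, Matrix.smul_apply, smul_eq_mul, Rat.cast_mul]

/-- `M ↦ M ⊗ 1` is injective. [folklore] -/
private theorem map_ratCast_inj₄₅ (M N : Matrix m m ℚ) (hMN : M.map ((↑) : ℚ → ℂ) = N.map ((↑) : ℚ → ℂ)) : M = N :=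
  Matrix.map_injective Rat.cast_injective hMN

/-- `M ⊗_ℚ ℂ = (M ⊗_ℚ ℝ) ⊗_ℝ ℂ`. [folklore] -/
private theorem map_ratCast_complex₄₅ (M : Matrix m m ℚ) :
    M.map ((↑) : ℚ → ℂ) = (M.map (Rat.cast : ℚ → ℝ)).map Complex.ofRealHom := by
  ext i j; simp only [Matrix.map_apply, Complex.ofRealHom_eq_coe, Complex.ofReal_ratCast]

/-- `J (a h + b e + c f) = (a h + b e + c f) J` when `J` commutes with `h, e, f`. [folklore] -/
private theorem comm_smul_add₄₅ {R : Type*} [CommRing R] [Fintype m] {J h e f : Matrix m m R} (ch : J * h = h * J)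
    (ce : J * e = e * J) (cf : J * f = f * J) (a b c : R) :
    J * (a • h + b • e + c • f) = (a • h + b • e + c • f) * J := by
  rw [mul_add, mul_add, add_mul, add_mul, mul_smul_comm, mul_smul_comm, mul_smul_comm, smul_mul_assoc, smul_mul_assoc,
    smul_mul_assoc, ch, ce, cf]

end CastLemmas

/-! ### §1 The graph `q : 𝒜(X) ↠ 𝔰𝔩₂(ℚ)` and the rational `𝔰𝔩₂`-triple in `𝒜(X)` -/

section Graph

variable {ι₁ : Type*} [Fintype ι₁] [DecidableEq ι₁] {E₁ : Type*} [NormedAddCommGroup E₁] [NormedSpace ℂ E₁]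
  {Φ₁ : (ι₁ → ℝ) ≃L[ℝ] E₁} {η₁ : E₁ [⋀^Fin 2]→L[ℝ] ℝ} {τ : ℂ} (hτ : τ.im ≠ 0)

/-- **«`𝔥𝔤(X × E) = Γ_φ`»: the graph.**  For `X` polarised, `End(E_τ) = ℤ` and `Hg(X × E_τ)(ℂ) ≠ Hg(X)(ℂ) × Hg(E_τ)(ℂ)` there is a
SURJECTIVE homomorphism of `ℚ`-Lie algebras `q : 𝒜(X) → 𝒜(E_τ) = 𝔰𝔩₂(ℚ)` whose graph is `𝒜(X × E_τ)`: for every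
`C ∈ 𝒜(X × E_τ)`, `q(C₁₁) = C₂₂` (`𝒜(E_τ)` is `ℚ`-simple, so the Goursat ideal `𝔤₂` vanishes and `r₁` is bijective).
[cite: MoonenZarhin1999LowDim, §3 (3.1) and Lemma (3.3)–(3.4) (proof: "`𝔥𝔤(X) = 𝔤₁ ⊕ 𝔤₃ ≅ 𝔥𝔤(X₁)`", "`𝔥𝔤(X × Y) = Γ_φ`")]
[cite: Gordon1997, §2.16 Proposition] -/
theorem exists_lieHom_graph_of_hodgeGroupC_prod_ellipticPeriod_ne (hE : ellipticEnd hτ = ⊥)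
    (hne : hodgeGroupC (prodPeriod Φ₁ (ellipticPeriod hτ)) ≠
      blockDiagProd (hodgeGroupC Φ₁) (hodgeGroupC (ellipticPeriod hτ))) :
    ∃ q : hodgeGroupLieRat Φ₁ →ₗ⁅ℚ⁆ hodgeGroupLieRat (ellipticPeriod hτ), Surjective q ∧
      ∀ (C : Matrix (ι₁ ⊕ Fin 2) (ι₁ ⊕ Fin 2) ℚ) (hC : C ∈ hodgeGroupLieRat (prodPeriod Φ₁ (ellipticPeriod hτ))),
        ((q ⟨C.toBlocks₁₁, toBlocks₁₁_mem_hodgeGroupLieRat Φ₁ (ellipticPeriod hτ) hC⟩ : hodgeGroupLieRat (ellipticPeriod hτ)) :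
          Matrix (Fin 2) (Fin 2) ℚ) = C.toBlocks₂₂ := by
  obtain ⟨f, g, hf, hg, hfs, hgs, hker⟩ := exists_lieHom_toBlocks_rat Φ₁ (ellipticPeriod hτ)
  haveI := finite_hodgeGroupLieRat (prodPeriod Φ₁ (ellipticPeriod hτ))
  haveI := finite_hodgeGroupLieRat Φ₁
  haveI := finite_hodgeGroupLieRat (ellipticPeriod hτ)
  haveI : LieAlgebra.IsSimple ℂ (lieSubalgebraGL ((hodgeGroupC (ellipticPeriod hτ)).map Matrix.SpecialLinearGroup.toGL)) :=
    isSimple_lieSubalgebraGL_map_toGL_hodgeGroupC_ellipticPeriod hτ hE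
  haveI : LieAlgebra.IsSimple ℂ (hodgeGroupComplexLie (ellipticPeriod hτ)) :=
    (isSimple_hodgeGroupComplexLie_iff (ellipticPeriod hτ)).2 inferInstance
  haveI : LieAlgebra.IsSimple ℚ (hodgeGroupLieRat (ellipticPeriod hτ)) :=
    isSimple_hodgeGroupLieRat_of_isSimple_hodgeGroupComplexLie (ellipticPeriod hτ)
  have hker' : g.ker ⊓ f.ker = ⊥ := by rw [inf_comm, hker]
  rcases LieAlgebra.IsSimple.eq_bot_or_eq_top (LieIdeal.map g f.ker) with h | h
  · have hinj : Injective f := GoursatLemma.injective_of_map_ker_eq_bot g f hker' h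
    let r₁ := LieEquiv.ofBijective f ⟨hinj, hfs⟩
    refine ⟨g.comp (r₁.symm : hodgeGroupLieRat Φ₁ →ₗ⁅ℚ⁆ hodgeGroupLieRat (prodPeriod Φ₁ (ellipticPeriod hτ))), ?_, ?_⟩
    · intro b
      obtain ⟨x, rfl⟩ := hgs b
      exact ⟨r₁ x, by rw [LieHom.comp_apply, LieEquiv.coe_coe, LieEquiv.symm_apply_apply]⟩
    · intro C hC
      have h1 : (⟨C.toBlocks₁₁, toBlocks₁₁_mem_hodgeGroupLieRat Φ₁ (ellipticPeriod hτ) hC⟩ : hodgeGroupLieRat Φ₁) = r₁ ⟨C, hC⟩ :=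
        Subtype.ext (hf ⟨C, hC⟩).symm
      rw [h1, LieHom.comp_apply, LieEquiv.coe_coe, LieEquiv.symm_apply_apply, hg]
  · exfalso
    rw [← GoursatLemma.map_ker_eq_top_iff f g hfs hgs] at h
    exact hne ((finrank_hodgeGroupLieRat_prod_eq_add_iff Φ₁ (ellipticPeriod hτ)).1
      ((GoursatLemma.finrank_eq_add_iff_map_ker_eq_top f g hfs hgs hker).2 h))

omit hτ in
/-- The standard basis of `𝔰𝔩₂(ℚ)` decomposes every traceless `2 × 2` matrix. [cite: Bourbaki2008LieGroups79, Ch. VIII §1 no. 1] -/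
private theorem fin_two_eq_smul_add₄₅ (Z : Matrix (Fin 2) (Fin 2) ℚ) (hZ : Z.trace = 0) :
    Z = Z 0 0 • !![(1 : ℚ), 0; 0, -1] + Z 0 1 • !![(0 : ℚ), 1; 0, 0] + Z 1 0 • !![(0 : ℚ), 0; 1, 0] := by
  rw [Matrix.trace_fin_two] at hZ
  have h11 : Z 1 1 = -Z 0 0 := by linear_combination hZ
  ext i j
  fin_cases i <;> fin_cases j <;> simp [h11]

/-- **«`𝔥𝔤(X₁) = 𝔤₁ ⊕ 𝔤₃`, `𝔤₃ ≅ 𝔥𝔤(E) = 𝔰𝔩₂`» — A RATIONAL `𝔰𝔩₂`-TRIPLE IN `𝒜(X)`.**  For `X` polarised, `End(E_τ) = ℤ` and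
`Hg(X × E_τ)(ℂ) ≠ Hg(X)(ℂ) × Hg(E_τ)(ℂ)` there are `h, e, f ∈ 𝒜(X)`, `h ≠ 0`, with `[h,e] = 2e`, `[h,f] = -2f`, `[e,f] = h`,
such that: the «kernel» `𝔤₁ = {A ∈ 𝒜(X) | (A 0; 0 0) ∈ 𝒜(X × E_τ)}` commutes with `h, e, f`; `𝒜(X) = 𝔤₁ + ℚh + ℚe + ℚf`; and
every `C ∈ 𝒜(X × E_τ)` reads `C = (A₀ + a h + b e + c f  0; 0  (a b; c -a))` with `A₀ ∈ 𝔤₁` (the graph of `q`, with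
`q(h), q(e), q(f) = H, E, F`).  The complement `ℚh + ℚe + ℚf` of `𝔤₁ = ker q` is an ideal because `𝒜(X)` is reductive.
[cite: MoonenZarhin1999LowDim, §3 (3.1) and Lemma (3.4) (proof)] [cite: Bourbaki1989LieGroups13, Ch. I §6 no. 4 Cor. (b) of Prop. 5]
[cite: Gordon1997, §2.16 Proposition] -/
theorem IsRiemannForm.exists_sl2Triple_hodgeGroupLieRat_of_hodgeGroupC_prod_ellipticPeriod_ne (hη₁ : IsRiemannForm Φ₁ η₁)
    (hE : ellipticEnd hτ = ⊥)
    (hne : hodgeGroupC (prodPeriod Φ₁ (ellipticPeriod hτ)) ≠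
      blockDiagProd (hodgeGroupC Φ₁) (hodgeGroupC (ellipticPeriod hτ))) :
    ∃ h e f : Matrix ι₁ ι₁ ℚ, h ∈ hodgeGroupLieRat Φ₁ ∧ e ∈ hodgeGroupLieRat Φ₁ ∧ f ∈ hodgeGroupLieRat Φ₁ ∧ h ≠ 0 ∧
      h * e - e * h = (2 : ℚ) • e ∧ h * f - f * h = -((2 : ℚ) • f) ∧ e * f - f * e = h ∧
      (∀ A ∈ hodgeGroupLieRat Φ₁,
        Matrix.fromBlocks A 0 0 (0 : Matrix (Fin 2) (Fin 2) ℚ) ∈ hodgeGroupLieRat (prodPeriod Φ₁ (ellipticPeriod hτ)) →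
          A * h = h * A ∧ A * e = e * A ∧ A * f = f * A) ∧
      (∀ A ∈ hodgeGroupLieRat Φ₁, ∃ A₀ ∈ hodgeGroupLieRat Φ₁, ∃ a b c : ℚ,
        Matrix.fromBlocks A₀ 0 0 (0 : Matrix (Fin 2) (Fin 2) ℚ) ∈ hodgeGroupLieRat (prodPeriod Φ₁ (ellipticPeriod hτ)) ∧
          A = A₀ + a • h + b • e + c • f) ∧
      ∀ C ∈ hodgeGroupLieRat (prodPeriod Φ₁ (ellipticPeriod hτ)), ∃ A₀ ∈ hodgeGroupLieRat Φ₁, ∃ a b c : ℚ,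
        Matrix.fromBlocks A₀ 0 0 (0 : Matrix (Fin 2) (Fin 2) ℚ) ∈ hodgeGroupLieRat (prodPeriod Φ₁ (ellipticPeriod hτ)) ∧
          C.toBlocks₁₁ = A₀ + a • h + b • e + c • f ∧ C.toBlocks₂₂ = !![a, b; c, -a] := by
  letI : LieRing (Matrix ι₁ ι₁ ℚ) := LieRing.ofAssociativeRing
  letI : LieAlgebra ℚ (Matrix ι₁ ι₁ ℚ) := LieAlgebra.ofAssociativeAlgebra
  letI : LieRing (Matrix (Fin 2) (Fin 2) ℚ) := LieRing.ofAssociativeRing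
  letI : LieAlgebra ℚ (Matrix (Fin 2) (Fin 2) ℚ) := LieAlgebra.ofAssociativeAlgebra
  obtain ⟨q, hqs, hgraph⟩ := exists_lieHom_graph_of_hodgeGroupC_prod_ellipticPeriod_ne (Φ₁ := Φ₁) hτ hE hne
  haveI := hη₁.hasCentralRadical_hodgeGroupLieRat
  haveI := finite_hodgeGroupLieRat Φ₁
  -- `ker q = {A | (A 0; 0 0) ∈ 𝒫}`
  have hker : ∀ (A : Matrix ι₁ ι₁ ℚ) (hA : A ∈ hodgeGroupLieRat Φ₁), q ⟨A, hA⟩ = 0 ↔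
      Matrix.fromBlocks A 0 0 (0 : Matrix (Fin 2) (Fin 2) ℚ) ∈ hodgeGroupLieRat (prodPeriod Φ₁ (ellipticPeriod hτ)) := by
    intro A hA
    constructor
    · intro h0
      obtain ⟨C, hC, hCA⟩ := exists_mem_hodgeGroupLieRat_prod_toBlocks₁₁_eq Φ₁ (ellipticPeriod hτ) hA
      have h1 := hgraph C hC
      have h2 : (⟨C.toBlocks₁₁, toBlocks₁₁_mem_hodgeGroupLieRat Φ₁ (ellipticPeriod hτ) hC⟩ : hodgeGroupLieRat Φ₁) = ⟨A, hA⟩ :=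
        Subtype.ext hCA
      rw [h2, h0, ZeroMemClass.coe_zero] at h1
      rw [eq_fromBlocks_of_mem_hodgeGroupLieRat_prod Φ₁ (ellipticPeriod hτ) hC, hCA, ← h1] at hC
      exact hC
    · intro hC
      have h1 := hgraph _ hC
      have h2 : (⟨(Matrix.fromBlocks A 0 0 (0 : Matrix (Fin 2) (Fin 2) ℚ)).toBlocks₁₁,
          toBlocks₁₁_mem_hodgeGroupLieRat Φ₁ (ellipticPeriod hτ) hC⟩ : hodgeGroupLieRat Φ₁) = ⟨A, hA⟩ :=
        Subtype.ext (Matrix.toBlocks_fromBlocks₁₁ _ _ _ _)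
      rw [h2, Matrix.toBlocks_fromBlocks₂₂] at h1
      exact Subtype.ext (by rw [h1, ZeroMemClass.coe_zero])
  -- the complement ideal `𝔰` of `ker q`
  obtain ⟨S, hIS⟩ := exists_ideal_isCompl (k := ℚ) (L := hodgeGroupLieRat Φ₁) q.ker
  -- the standard triple of `𝒜(E_τ) = 𝔰𝔩₂(ℚ)`
  have hmemE : ∀ W : Matrix (Fin 2) (Fin 2) ℚ, W.trace = 0 → W ∈ hodgeGroupLieRat (ellipticPeriod hτ) := fun W hW ↦
    (mem_hodgeGroupLieRat_ellipticPeriod_iff_of_eq_bot hτ hE).2 hW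
  set H₀ : hodgeGroupLieRat (ellipticPeriod hτ) := ⟨!![(1 : ℚ), 0; 0, -1], hmemE _ (by simp [Matrix.trace_fin_two])⟩ with hH₀
  set E₀ : hodgeGroupLieRat (ellipticPeriod hτ) := ⟨!![(0 : ℚ), 1; 0, 0], hmemE _ (by simp [Matrix.trace_fin_two])⟩ with hE₀
  set F₀ : hodgeGroupLieRat (ellipticPeriod hτ) := ⟨!![(0 : ℚ), 0; 1, 0], hmemE _ (by simp [Matrix.trace_fin_two])⟩ with hF₀
  have rHE : ⁅H₀, E₀⁆ = (2 : ℚ) • E₀ := Subtype.ext (by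
    rw [LieSubalgebra.coe_bracket, Ring.lie_def, SetLike.val_smul, hH₀, hE₀]
    ext i j; fin_cases i <;> fin_cases j <;> norm_num)
  have rHF : ⁅H₀, F₀⁆ = -((2 : ℚ) • F₀) := Subtype.ext (by
    rw [LieSubalgebra.coe_bracket, Ring.lie_def, NegMemClass.coe_neg, SetLike.val_smul, hH₀, hF₀]
    ext i j; fin_cases i <;> fin_cases j <;> norm_num)
  have rEF : ⁅E₀, F₀⁆ = H₀ := Subtype.ext (by
    rw [LieSubalgebra.coe_bracket, Ring.lie_def, hH₀, hE₀, hF₀]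
    ext i j; fin_cases i <;> fin_cases j <;> norm_num)
  -- lifts in `𝔰`
  have hlift : ∀ Y : hodgeGroupLieRat (ellipticPeriod hτ), ∃ y : hodgeGroupLieRat Φ₁, y ∈ S ∧ q y = Y := by
    intro Y
    obtain ⟨y, hy⟩ := hqs Y
    have hy' : y ∈ q.ker ⊔ S := by rw [hIS.sup_eq_top]; exact LieSubmodule.mem_top _
    obtain ⟨yI, hyI, yS, hyS, hsum⟩ := (LieSubmodule.mem_sup _ _ _).1 hy'
    refine ⟨yS, hyS, ?_⟩
    rw [LieHom.mem_ker] at hyI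
    rw [← hy, ← hsum, map_add, hyI, zero_add]
  obtain ⟨xh, hxhS, hqh⟩ := hlift H₀
  obtain ⟨xe, hxeS, hqe⟩ := hlift E₀
  obtain ⟨xf, hxfS, hqf⟩ := hlift F₀
  -- `ker q ∩ 𝔰 = 0`
  have hIS0 : ∀ y : hodgeGroupLieRat Φ₁, y ∈ q.ker → y ∈ S → y = 0 := by
    intro y h1 h2
    have h3 : y ∈ q.ker ⊓ S := (LieSubmodule.mem_inf _ _ _).2 ⟨h1, h2⟩
    rw [hIS.inf_eq_bot] at h3
    exact (LieSubmodule.mem_bot _).1 h3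
  -- the relations lift
  have rhe : ⁅xh, xe⁆ = (2 : ℚ) • xe := by
    have h1 : ⁅xh, xe⁆ - (2 : ℚ) • xe = 0 := hIS0 _
      (by rw [LieHom.mem_ker, map_sub, map_smul, LieHom.map_lie, hqh, hqe, rHE, sub_self])
      (S.sub_mem (S.lie_mem hxeS) (S.smul_mem _ hxeS))
    exact sub_eq_zero.1 h1
  have rhf : ⁅xh, xf⁆ = -((2 : ℚ) • xf) := by
    have h1 : ⁅xh, xf⁆ + (2 : ℚ) • xf = 0 := hIS0 _
      (by rw [LieHom.mem_ker, map_add, map_smul, LieHom.map_lie, hqh, hqf, rHF, neg_add_cancel])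
      (S.add_mem (S.lie_mem hxfS) (S.smul_mem _ hxfS))
    exact eq_neg_of_add_eq_zero_left h1
  have ref : ⁅xe, xf⁆ = xh := by
    have h1 : ⁅xe, xf⁆ - xh = 0 := hIS0 _
      (by rw [LieHom.mem_ker, map_sub, LieHom.map_lie, hqe, hqf, rEF, hqh, sub_self])
      (S.sub_mem (S.lie_mem hxfS) hxhS)
    exact sub_eq_zero.1 h1
  -- every `s ∈ 𝔰` is `a xh + b xe + c xf`
  have hspan : ∀ s : hodgeGroupLieRat Φ₁, s ∈ S → ∃ a b c : ℚ, s = a • xh + b • xe + c • xf := by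
    intro s hs
    set Y : Matrix (Fin 2) (Fin 2) ℚ := ((q s : hodgeGroupLieRat (ellipticPeriod hτ)) : Matrix (Fin 2) (Fin 2) ℚ) with hY
    have hYtr : Y.trace = 0 := (mem_hodgeGroupLieRat_ellipticPeriod_iff_of_eq_bot hτ hE).1 (q s).2
    refine ⟨Y 0 0, Y 0 1, Y 1 0, ?_⟩
    have h1 : q s = Y 0 0 • H₀ + Y 0 1 • E₀ + Y 1 0 • F₀ := Subtype.ext (by
      rw [AddMemClass.coe_add, AddMemClass.coe_add, SetLike.val_smul, SetLike.val_smul, SetLike.val_smul, hH₀, hE₀, hF₀]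
      exact fin_two_eq_smul_add₄₅ Y hYtr)
    have h2 : s - (Y 0 0 • xh + Y 0 1 • xe + Y 1 0 • xf) = 0 := hIS0 _
      (by rw [LieHom.mem_ker, map_sub, map_add, map_add, map_smul, map_smul, map_smul, hqh, hqe, hqf, h1, sub_self])
      (S.sub_mem hs (S.add_mem (S.add_mem (S.smul_mem _ hxhS) (S.smul_mem _ hxeS)) (S.smul_mem _ hxfS)))
    exact sub_eq_zero.1 h2
  -- the decomposition of an arbitrary `y ∈ 𝒜(X)`
  have hdec : ∀ y : hodgeGroupLieRat Φ₁, ∃ yI : hodgeGroupLieRat Φ₁, q yI = 0 ∧ ∃ a b c : ℚ, y = yI + (a • xh + b • xe + c • xf) := by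
    intro y
    have hy' : y ∈ q.ker ⊔ S := by rw [hIS.sup_eq_top]; exact LieSubmodule.mem_top _
    obtain ⟨yI, hyI, yS, hyS, hsum⟩ := (LieSubmodule.mem_sup _ _ _).1 hy'
    obtain ⟨a, b, c, hySabc⟩ := hspan yS hyS
    exact ⟨yI, LieHom.mem_ker.1 hyI, a, b, c, by rw [← hsum, hySabc]⟩
  -- `ker q` commutes with `𝔰`
  have hcomm : ∀ y : hodgeGroupLieRat Φ₁, q y = 0 → ∀ s : hodgeGroupLieRat Φ₁, s ∈ S → (y : Matrix ι₁ ι₁ ℚ) * s = s * y := by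
    intro y hy s hs
    have h1 : ⁅y, s⁆ = 0 := hIS0 _ (by rw [LieHom.mem_ker, LieHom.map_lie, hy, zero_lie]) (S.lie_mem hs)
    have h2 := congrArg Subtype.val h1
    rw [LieSubalgebra.coe_bracket, Ring.lie_def, ZeroMemClass.coe_zero] at h2
    exact sub_eq_zero.1 h2
  refine ⟨xh, xe, xf, xh.2, xe.2, xf.2, ?_, ?_, ?_, ?_, ?_, ?_, ?_⟩
  · -- `h ≠ 0`
    intro h0
    have h1 : xh = 0 := Subtype.ext h0
    have h2 := congrArg (fun Y : hodgeGroupLieRat (ellipticPeriod hτ) ↦ (Y : Matrix (Fin 2) (Fin 2) ℚ) 0 0) hqh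
    simp only [h1, map_zero, ZeroMemClass.coe_zero, Matrix.zero_apply, hH₀] at h2
    norm_num at h2
  · have h1 := congrArg Subtype.val rhe
    rwa [LieSubalgebra.coe_bracket, Ring.lie_def, SetLike.val_smul] at h1
  · have h1 := congrArg Subtype.val rhf
    rwa [LieSubalgebra.coe_bracket, Ring.lie_def, NegMemClass.coe_neg, SetLike.val_smul] at h1
  · have h1 := congrArg Subtype.val ref
    rwa [LieSubalgebra.coe_bracket, Ring.lie_def] at h1
  · intro A hA hA0
    have hq0 : q ⟨A, hA⟩ = 0 := (hker A hA).2 hA0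
    exact ⟨hcomm ⟨A, hA⟩ hq0 xh hxhS, hcomm ⟨A, hA⟩ hq0 xe hxeS, hcomm ⟨A, hA⟩ hq0 xf hxfS⟩
  · intro A hA
    obtain ⟨yI, hyI, a, b, c, hy⟩ := hdec ⟨A, hA⟩
    refine ⟨yI, yI.2, a, b, c, (hker yI yI.2).1 (by simpa using hyI), ?_⟩
    have h1 := congrArg Subtype.val hy
    simpa only [AddMemClass.coe_add, SetLike.val_smul, add_assoc] using h1
  · intro C hC
    have hA := toBlocks₁₁_mem_hodgeGroupLieRat Φ₁ (ellipticPeriod hτ) hC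
    obtain ⟨yI, hyI, a, b, c, hy⟩ := hdec ⟨C.toBlocks₁₁, hA⟩
    refine ⟨yI, yI.2, a, b, c, (hker yI yI.2).1 (by simpa using hyI), ?_, ?_⟩
    · have h1 := congrArg Subtype.val hy
      simpa only [AddMemClass.coe_add, SetLike.val_smul, add_assoc] using h1
    · have h1 := hgraph C hC
      rw [hy, map_add, hyI, zero_add, map_add, map_add, map_smul, map_smul, map_smul, hqh, hqe, hqf] at h1
      rw [← h1, AddMemClass.coe_add, AddMemClass.coe_add, SetLike.val_smul, SetLike.val_smul, SetLike.val_smul, hH₀, hE₀, hF₀]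
      ext i j; fin_cases i <;> fin_cases j <;> simp

end Graph

/-! ### §2 «`Γ_{φ,ℂ} ∋ (J_X, J_E)`», «only `λ = 0`»: the standard-isotypic identities over `ℚ` -/

section ComplexPart

variable {ι₁ : Type*} [Fintype ι₁] [DecidableEq ι₁] {E₁ : Type*} [NormedAddCommGroup E₁] [NormedSpace ℂ E₁]
  {Φ₁ : (ι₁ → ℝ) ≃L[ℝ] E₁} {τ : ℂ} {hτ : τ.im ≠ 0} {h e f : Matrix ι₁ ι₁ ℚ}

/-- Lange's Prop. 1.1.6 read over `ℂ`: `c ∈ End⁰(X)` iff `c ⊗ 1` commutes with `J ⊗ 1`.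
[cite: Lange2023AbelianVarietiesComplex, §1.1.2 Prop. 1.1.6] -/
private theorem mem_endAlgRat_iff_map_ratCast_complex₄₅ {c : Matrix ι₁ ι₁ ℚ} :
    c ∈ endAlgRat Φ₁ ↔ c.map ((↑) : ℚ → ℂ) * (jMatrix Φ₁).map Complex.ofRealHom =
      (jMatrix Φ₁).map Complex.ofRealHom * c.map ((↑) : ℚ → ℂ) := by
  rw [mem_endAlgRat_iff Φ₁ c, map_ratCast_complex₄₅, ← Matrix.map_mul, ← Matrix.map_mul]
  exact ⟨fun h ↦ by rw [h], fun h ↦ Matrix.map_injective Complex.ofReal_injective h⟩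

/-- **«`Γ_{φ,ℂ} ∋ J_{X×Y} = (J_X, J_Y)`» in coordinates**: `J ⊗ 1 = J_I + (α h + β e + γ f)` with `J_I ∈ 𝔤₁ ⊗ ℂ` commuting
with `h, e, f` (because `J ⊗ 1 ∈ 𝒜(X) ⊗ ℂ = (𝔤₁ ⊕ 𝔰) ⊗ ℂ`). [cite: MoonenZarhin1999LowDim, §3 Lemma (3.3) (proof)] -/
private theorem exists_jMatrix_map_eq_add₄₅
    (hK : ∀ A ∈ hodgeGroupLieRat Φ₁,
      Matrix.fromBlocks A 0 0 (0 : Matrix (Fin 2) (Fin 2) ℚ) ∈ hodgeGroupLieRat (prodPeriod Φ₁ (ellipticPeriod hτ)) →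
        A * h = h * A ∧ A * e = e * A ∧ A * f = f * A)
    (hdec : ∀ A ∈ hodgeGroupLieRat Φ₁, ∃ A₀ ∈ hodgeGroupLieRat Φ₁, ∃ a b c : ℚ,
      Matrix.fromBlocks A₀ 0 0 (0 : Matrix (Fin 2) (Fin 2) ℚ) ∈ hodgeGroupLieRat (prodPeriod Φ₁ (ellipticPeriod hτ)) ∧
        A = A₀ + a • h + b • e + c • f) :
    ∃ JI : Matrix ι₁ ι₁ ℂ, ∃ α β γ : ℂ,
      JI * h.map ((↑) : ℚ → ℂ) = h.map ((↑) : ℚ → ℂ) * JI ∧ JI * e.map ((↑) : ℚ → ℂ) = e.map ((↑) : ℚ → ℂ) * JI ∧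
        JI * f.map ((↑) : ℚ → ℂ) = f.map ((↑) : ℚ → ℂ) * JI ∧
        (jMatrix Φ₁).map Complex.ofRealHom =
          JI + (α • h.map ((↑) : ℚ → ℂ) + β • e.map ((↑) : ℚ → ℂ) + γ • f.map ((↑) : ℚ → ℂ)) := by
  have hJ := (mem_hodgeGroupLieC_iff_mem_span_hodgeGroupLieRat Φ₁).1 (jMatrix_map_mem_hodgeGroupLieC (Φ := Φ₁))
  refine Submodule.span_induction (p := fun Z _ ↦ ∃ JI : Matrix ι₁ ι₁ ℂ, ∃ α β γ : ℂ,
      JI * h.map ((↑) : ℚ → ℂ) = h.map ((↑) : ℚ → ℂ) * JI ∧ JI * e.map ((↑) : ℚ → ℂ) = e.map ((↑) : ℚ → ℂ) * JI ∧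
        JI * f.map ((↑) : ℚ → ℂ) = f.map ((↑) : ℚ → ℂ) * JI ∧
        Z = JI + (α • h.map ((↑) : ℚ → ℂ) + β • e.map ((↑) : ℚ → ℂ) + γ • f.map ((↑) : ℚ → ℂ))) ?_ ?_ ?_ ?_ hJ
  · rintro _ ⟨A, hA, rfl⟩
    obtain ⟨A₀, hA₀, a, b, c, hA₀P, hAeq⟩ := hdec A hA
    obtain ⟨ch, ce, cf⟩ := hK A₀ hA₀ hA₀P
    refine ⟨A₀.map ((↑) : ℚ → ℂ), a, b, c, ?_, ?_, ?_, ?_⟩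
    · rw [← map_ratCast_mul₄₅, ch, map_ratCast_mul₄₅]
    · rw [← map_ratCast_mul₄₅, ce, map_ratCast_mul₄₅]
    · rw [← map_ratCast_mul₄₅, cf, map_ratCast_mul₄₅]
    · change A.map ((↑) : ℚ → ℂ) = _
      rw [hAeq, map_ratCast_add₄₅, map_ratCast_add₄₅, map_ratCast_add₄₅, map_ratCast_smul₄₅, map_ratCast_smul₄₅,
        map_ratCast_smul₄₅, add_assoc, add_assoc, add_assoc]
  · exact ⟨0, 0, 0, 0, by rw [zero_mul, mul_zero], by rw [zero_mul, mul_zero], by rw [zero_mul, mul_zero], by simp⟩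
  · rintro Z W - - ⟨J₁, α₁, β₁, γ₁, c1h, c1e, c1f, h1⟩ ⟨J₂, α₂, β₂, γ₂, c2h, c2e, c2f, h2⟩
    refine ⟨J₁ + J₂, α₁ + α₂, β₁ + β₂, γ₁ + γ₂, by rw [add_mul, mul_add, c1h, c2h], by rw [add_mul, mul_add, c1e, c2e],
      by rw [add_mul, mul_add, c1f, c2f], ?_⟩
    rw [h1, h2]; module
  · rintro r Z - ⟨J₁, α₁, β₁, γ₁, c1h, c1e, c1f, h1⟩
    refine ⟨r • J₁, r * α₁, r * β₁, r * γ₁, by rw [smul_mul_assoc, mul_smul_comm, c1h],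
      by rw [smul_mul_assoc, mul_smul_comm, c1e], by rw [smul_mul_assoc, mul_smul_comm, c1f], ?_⟩
    rw [h1]; module

/-- **THE STANDARD-ISOTYPIC IDENTITIES over `ℚ`** for the rational triple `(h, e, f) ⊂ 𝒜(X)`, `h ≠ 0`, once
`J ⊗ 1 = J_I + x`, `x = α h + β e + γ f`, `J_I` commuting with `h, e, f`:  MZ's eigenvalue count («both `i + λ` and `-i + λ`
occur … only if `λ = 0`», here `α² + βγ = -1` and the `𝔰𝔩₂`-weights lemma for the triple through `-i x`) gives
`e² = f² = 0`, `h e = e = -e h`, `h f = -f = -f h`, `e f + f e = h² = P`, `h P = h`; moreover every rational `c = P c`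
commuting with `h, e, f` commutes with `J` (as `J P = P J = x`), i.e. lies in `End⁰(X)` (Lange 1.1.6).
[cite: MoonenZarhin1999LowDim, §3 Lemma (3.3) (proof) and §2 (2.2)–(2.3)] [cite: Lange2023AbelianVarietiesComplex, §1.1.2 Prop. 1.1.6] -/
private theorem sl2Triple_identities₄₅ (hh : h ∈ hodgeGroupLieRat Φ₁) (h0 : h ≠ 0)
    (rhe : h * e - e * h = (2 : ℚ) • e) (rhf : h * f - f * h = -((2 : ℚ) • f)) (ref : e * f - f * e = h)
    {JI : Matrix ι₁ ι₁ ℂ} {α β γ : ℂ} (cJh : JI * h.map ((↑) : ℚ → ℂ) = h.map ((↑) : ℚ → ℂ) * JI)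
    (cJe : JI * e.map ((↑) : ℚ → ℂ) = e.map ((↑) : ℚ → ℂ) * JI) (cJf : JI * f.map ((↑) : ℚ → ℂ) = f.map ((↑) : ℚ → ℂ) * JI)
    (hJc : (jMatrix Φ₁).map Complex.ofRealHom =
      JI + (α • h.map ((↑) : ℚ → ℂ) + β • e.map ((↑) : ℚ → ℂ) + γ • f.map ((↑) : ℚ → ℂ))) :
    e * e = 0 ∧ f * f = 0 ∧ h * e = e ∧ e * h = -e ∧ h * f = -f ∧ f * h = f ∧ e * f + f * e = h * h ∧
      h * h * h = h ∧
      ∀ c : Matrix ι₁ ι₁ ℚ, h * h * c = c → h * c = c * h → e * c = c * e → f * c = c * f → c ∈ endAlgRat Φ₁ := by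
  -- names: `hc, ec, fc = h, e, f ⊗ 1`, `Jc = J ⊗ 1`, `x = α hc + β ec + γ fc`
  obtain ⟨hc, hhc⟩ : ∃ hc, hc = h.map ((↑) : ℚ → ℂ) := ⟨_, rfl⟩
  obtain ⟨ec, hec⟩ : ∃ ec, ec = e.map ((↑) : ℚ → ℂ) := ⟨_, rfl⟩
  obtain ⟨fc, hfc⟩ : ∃ fc, fc = f.map ((↑) : ℚ → ℂ) := ⟨_, rfl⟩
  obtain ⟨Jc, hJc'⟩ : ∃ Jc, Jc = (jMatrix Φ₁).map Complex.ofRealHom := ⟨_, rfl⟩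
  rw [← hhc] at cJh hJc
  rw [← hec] at cJe hJc
  rw [← hfc] at cJf hJc
  rw [← hJc'] at hJc
  obtain ⟨x, hx⟩ : ∃ x, x = α • hc + β • ec + γ • fc := ⟨_, rfl⟩
  rw [← hx] at hJc
  -- the relations over `ℂ`, `(J ⊗ 1)² = -1`
  have rhe' : hc * ec - ec * hc = (2 : ℂ) • ec := by
    rw [hhc, hec, ← map_ratCast_mul₄₅, ← map_ratCast_mul₄₅, ← map_ratCast_sub₄₅, rhe, map_ratCast_smul₄₅, Rat.cast_ofNat]
  have rhf' : hc * fc - fc * hc = -((2 : ℂ) • fc) := by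
    rw [hhc, hfc, ← map_ratCast_mul₄₅, ← map_ratCast_mul₄₅, ← map_ratCast_sub₄₅, rhf, ← neg_smul, map_ratCast_smul₄₅,
      Rat.cast_neg, Rat.cast_ofNat, neg_smul]
  have ref' : ec * fc - fc * ec = hc := by
    rw [hhc, hec, hfc, ← map_ratCast_mul₄₅, ← map_ratCast_mul₄₅, ← map_ratCast_sub₄₅, ref]
  have hJ2 : Jc * Jc = -1 := by rw [hJc']; exact map_ofRealHom_mul_self_of_mul_self (jMatrix_mul_jMatrix Φ₁)
  -- `J_I` commutes with `ℂ h + ℂ e + ℂ f`, so `ad x = ad (J ⊗ 1)` there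
  have cJ : ∀ a b c : ℂ, JI * (a • hc + b • ec + c • fc) = (a • hc + b • ec + c • fc) * JI :=
    comm_smul_add₄₅ cJh cJe cJf
  have hxJ : ∀ a b c : ℂ, x * (a • hc + b • ec + c • fc) - (a • hc + b • ec + c • fc) * x =
      Jc * (a • hc + b • ec + c • fc) - (a • hc + b • ec + c • fc) * Jc := by
    intro a b c; rw [hJc, add_mul JI x, mul_add (a • hc + b • ec + c • fc) JI x, cJ]; abel
  have hcl : ∀ a b c : ℂ, ∃ a' b' c' : ℂ,
      x * (a • hc + b • ec + c • fc) - (a • hc + b • ec + c • fc) * x = a' • hc + b' • ec + c' • fc := by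
    intro a b c; rw [hx]; exact ⟨_, _, _, sl2_comm_smul_add rhe' rhf' ref' α β γ a b c⟩
  -- «on each summand `J_X` has `± i` as its eigenvalues»: `(ad x)³ = (ad J)³ = -4 ad J = -4 ad x` on `h, e, f`
  have had : ∀ a b c : ℂ,
      x * (x * (x * (a • hc + b • ec + c • fc) - (a • hc + b • ec + c • fc) * x) -
            (x * (a • hc + b • ec + c • fc) - (a • hc + b • ec + c • fc) * x) * x) -
          (x * (x * (a • hc + b • ec + c • fc) - (a • hc + b • ec + c • fc) * x) -
            (x * (a • hc + b • ec + c • fc) - (a • hc + b • ec + c • fc) * x) * x) * x =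
        -(4 • (x * (a • hc + b • ec + c • fc) - (a • hc + b • ec + c • fc) * x)) := by
    intro a b c
    obtain ⟨a₁, b₁, c₁, h1⟩ := hcl a b c
    obtain ⟨a₂, b₂, c₂, h2⟩ := hcl a₁ b₁ c₁
    rw [h1, h2, hxJ, ← h2, hxJ, ← h1, hxJ]
    exact adCube_eq_neg_four_smul_of_mul_self_eq_neg_one hJ2 _
  have had' : ∀ s ∈ ({hc, ec, fc} : Set (Matrix ι₁ ι₁ ℂ)),
      x * (x * (x * s - s * x) - (x * s - s * x) * x) - (x * (x * s - s * x) - (x * s - s * x) * x) * x =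
        -(4 • (x * s - s * x)) := by
    intro s hs
    simp only [Set.mem_insert_iff, Set.mem_singleton_iff] at hs
    rcases hs with rfl | rfl | rfl
    · simpa only [one_smul, zero_smul, add_zero] using had 1 0 0
    · simpa only [one_smul, zero_smul, add_zero, zero_add] using had 0 1 0
    · simpa only [one_smul, zero_smul, zero_add] using had 0 0 1
  -- «this is possible only if `λ = 0`»: `x` does not commute with `𝔰` (else `e ∈ End⁰(X)` commutes with `h`: Lange 7.2.5)
  have hnc : ¬ (x * hc = hc * x ∧ x * ec = ec * x ∧ x * fc = fc * x) := by
    rintro ⟨-, hxe, -⟩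
    have heEnd : e ∈ endAlgRat Φ₁ := by
      rw [mem_endAlgRat_iff_map_ratCast_complex₄₅, ← hec, ← hJc', hJc, mul_add, add_mul, cJe, hxe]
    have h1 := mul_comm_of_mem_hodgeGroupLieRat_of_mem_endAlgRat hh heEnd
    have he0 : e = 0 := by
      have h2 : (2 : ℚ) • e = 0 := by rw [← rhe, h1, sub_self]
      exact (smul_eq_zero.1 h2).resolve_left two_ne_zero
    exact h0 (by rw [← ref, he0, zero_mul, mul_zero, sub_self])
  have hd : α ^ 2 + β * γ = -1 := sl2_sq_add_mul_eq_neg_one_of_adCube rhe' rhf' ref' hx had' hnc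
  -- the adapted triple `(h', e', f')`, `h' = -i x`
  obtain ⟨a₁, b₁, c₁, a₂, b₂, c₂, R1, R2, R3, through⟩ := sl2_exists_triple_through rhe' rhf' ref' hd
  rw [← hx] at R1 R2 R3 through
  obtain ⟨h', hh'⟩ : ∃ h', h' = -Complex.I • x := ⟨_, rfl⟩
  obtain ⟨e', he'⟩ : ∃ e', e' = a₁ • hc + b₁ • ec + c₁ • fc := ⟨_, rfl⟩
  obtain ⟨f', hf'⟩ : ∃ f', f' = a₂ • hc + b₂ • ec + c₂ • fc := ⟨_, rfl⟩
  rw [← hh'] at R1 R2 R3 through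
  rw [← he'] at R1 R3 through
  rw [← hf'] at R2 R3 through
  have hIx : Complex.I • h' = x := by rw [hh', smul_smul, mul_neg, Complex.I_mul_I, neg_neg, one_smul]
  have h0' : h' ≠ 0 := by
    intro h0'
    have hx0 : x = 0 := by rw [← hIx, h0', smul_zero]
    exact hnc (by rw [hx0]; simp)
  have cJh' : JI * h' = h' * JI := by rw [hh', mul_smul_comm, smul_mul_assoc, hx, cJ]
  have cJe' : JI * e' = e' * JI := by rw [he', cJ]
  have cJf' : JI * f' = f' * JI := by rw [hf', cJ]
  have hJ' : (JI + Complex.I • h') * (JI + Complex.I • h') = -1 := by rw [hIx, ← hJc, hJ2]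
  -- the weights lemma (File `Sl2TripleComplexStructureWeights`, matrix form) for `(h', e', f')`, `J₁ = J_I`
  have sq := sl2Matrix_smul_add_mul_self_eq_of_sq_eq_neg_one h0' R1 R2 R3 cJh' cJe' cJf' hJ'
  have mulP := sl2Matrix_smul_add_mul_h_mul_h_of_sq_eq_neg_one h0' R1 R2 R3 cJh' cJe' cJf' hJ'
  have Pmul := sl2Matrix_h_mul_h_mul_smul_add_of_sq_eq_neg_one h0' R1 R2 R3 cJh' cJe' cJf' hJ'
  have J0 := sl2Matrix_mul_smul_add_eq_zero_of_sq_eq_neg_one h0' R1 R2 R3 cJh' cJe' cJf' hJ'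
  -- … transported to `ℂ h + ℂ e + ℂ f = ℂ h' + ℂ e' + ℂ f'` (same determinant)
  have hsq : ∀ a b c : ℂ,
      (a • hc + b • ec + c • fc) * (a • hc + b • ec + c • fc) = (a ^ 2 + b * c) • (h' * h') := by
    intro a b c
    obtain ⟨a', b', c', h1, h2⟩ := through a b c
    rw [h1, sq, h2]
  have hP : hc * hc = h' * h' := by simpa using hsq 1 0 0
  have hmulP : ∀ a b c : ℂ, (a • hc + b • ec + c • fc) * (hc * hc) = a • hc + b • ec + c • fc := by
    intro a b c
    obtain ⟨a', b', c', h1, -⟩ := through a b c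
    rw [hP, h1]; exact mulP a' b' c'
  have hPmul : ∀ a b c : ℂ, hc * hc * (a • hc + b • ec + c • fc) = a • hc + b • ec + c • fc := by
    intro a b c
    obtain ⟨a', b', c', h1, -⟩ := through a b c
    rw [hP, h1]; exact Pmul a' b' c'
  have hJ0 : ∀ a b c : ℂ, JI * (a • hc + b • ec + c • fc) = 0 := by
    intro a b c
    obtain ⟨a', b', c', h1, -⟩ := through a b c
    rw [h1]; exact J0 a' b' c'
  -- the identities over `ℂ`
  have ee : ec * ec = 0 := by simpa using hsq 0 1 0
  have ff : fc * fc = 0 := by simpa using hsq 0 0 1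
  have hesum : hc * ec + ec * hc = 0 := by
    have h1 : (hc + ec) * (hc + ec) = hc * hc := by simpa [hP] using hsq 1 1 0
    rw [add_mul, mul_add, mul_add, ee, add_zero] at h1
    calc hc * ec + ec * hc = hc * hc + hc * ec + ec * hc - hc * hc := by abel
      _ = 0 := by rw [h1, sub_self]
  have he' : hc * ec = ec := by
    have h2 : (2 : ℂ) • (hc * ec) = (2 : ℂ) • ec := by
      rw [← rhe', two_smul]
      calc hc * ec + hc * ec = (hc * ec - ec * hc) + (hc * ec + ec * hc) := by abel
        _ = hc * ec - ec * hc := by rw [hesum, add_zero]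
    have h3 := congrArg (fun Z : Matrix ι₁ ι₁ ℂ ↦ (2 : ℂ)⁻¹ • Z) h2
    simpa only [smul_smul, inv_mul_cancel₀ (two_ne_zero : (2 : ℂ) ≠ 0), one_smul] using h3
  have eh' : ec * hc = -ec := by rw [eq_neg_of_add_eq_zero_right hesum, he']
  have hfsum : hc * fc + fc * hc = 0 := by
    have h1 : (hc + fc) * (hc + fc) = hc * hc := by simpa [hP] using hsq 1 0 1
    rw [add_mul, mul_add, mul_add, ff, add_zero] at h1
    calc hc * fc + fc * hc = hc * hc + hc * fc + fc * hc - hc * hc := by abel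
      _ = 0 := by rw [h1, sub_self]
  have hf' : hc * fc = -fc := by
    have h2 : (2 : ℂ) • (hc * fc) = (2 : ℂ) • (-fc) := by
      rw [smul_neg, ← rhf', two_smul]
      calc hc * fc + hc * fc = (hc * fc - fc * hc) + (hc * fc + fc * hc) := by abel
        _ = hc * fc - fc * hc := by rw [hfsum, add_zero]
    have h3 := congrArg (fun Z : Matrix ι₁ ι₁ ℂ ↦ (2 : ℂ)⁻¹ • Z) h2
    simpa only [smul_smul, inv_mul_cancel₀ (two_ne_zero : (2 : ℂ) ≠ 0), one_smul] using h3
  have fh' : fc * hc = fc := by rw [eq_neg_of_add_eq_zero_right hfsum, hf', neg_neg]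
  have ef' : ec * fc + fc * ec = hc * hc := by
    have h1 : (ec + fc) * (ec + fc) = hc * hc := by simpa [hP] using hsq 0 1 1
    rw [add_mul, mul_add, mul_add, ee, ff, zero_add, add_zero] at h1
    exact h1
  have hhh' : hc * hc * hc = hc := by
    have h1 := hmulP 1 0 0
    simp only [one_smul, zero_smul, add_zero] at h1
    rw [mul_assoc]; exact h1
  have hJP : Jc * (hc * hc) = x := by
    have h1 : JI * hc = 0 := by simpa using hJ0 1 0 0
    rw [hJc, add_mul, ← mul_assoc, h1, zero_mul, zero_add, hx, hmulP]
  have hPJ : hc * hc * Jc = x := by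
    have h1 : hc * JI = 0 := by rw [← cJh]; simpa using hJ0 1 0 0
    rw [hJc, mul_add, mul_assoc, h1, mul_zero, zero_add, hx, hPmul]
  -- … and over `ℚ`
  refine ⟨map_ratCast_inj₄₅ _ _ ?_, map_ratCast_inj₄₅ _ _ ?_, map_ratCast_inj₄₅ _ _ ?_, map_ratCast_inj₄₅ _ _ ?_,
    map_ratCast_inj₄₅ _ _ ?_, map_ratCast_inj₄₅ _ _ ?_, map_ratCast_inj₄₅ _ _ ?_, map_ratCast_inj₄₅ _ _ ?_, ?_⟩
  · rw [map_ratCast_mul₄₅, ← hec, ee, Matrix.map_zero _ Rat.cast_zero]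
  · rw [map_ratCast_mul₄₅, ← hfc, ff, Matrix.map_zero _ Rat.cast_zero]
  · rw [map_ratCast_mul₄₅, ← hhc, ← hec, he']
  · rw [map_ratCast_mul₄₅, Matrix.map_neg _ Rat.cast_neg, ← hhc, ← hec, eh']
  · rw [map_ratCast_mul₄₅, Matrix.map_neg _ Rat.cast_neg, ← hhc, ← hfc, hf']
  · rw [map_ratCast_mul₄₅, ← hhc, ← hfc, fh']
  · rw [map_ratCast_add₄₅, map_ratCast_mul₄₅, map_ratCast_mul₄₅, map_ratCast_mul₄₅, ← hhc, ← hec, ← hfc, ef']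
  · rw [map_ratCast_mul₄₅, map_ratCast_mul₄₅, ← hhc, hhh']
  · -- the `End⁰(X)`-criterion: `c = P c`, `[c, 𝔰] = 0` ⟹ `[c ⊗ 1, J ⊗ 1] = 0`
    intro c hPc hch hce hcf
    have hcP : c * (h * h) = c := by
      rw [← mul_assoc, ← hch, mul_assoc, ← hch, ← mul_assoc, hPc]
    have cch : c.map ((↑) : ℚ → ℂ) * hc = hc * c.map ((↑) : ℚ → ℂ) := by
      rw [hhc, ← map_ratCast_mul₄₅, ← hch, map_ratCast_mul₄₅]
    have cce : c.map ((↑) : ℚ → ℂ) * ec = ec * c.map ((↑) : ℚ → ℂ) := by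
      rw [hec, ← map_ratCast_mul₄₅, ← hce, map_ratCast_mul₄₅]
    have ccf : c.map ((↑) : ℚ → ℂ) * fc = fc * c.map ((↑) : ℚ → ℂ) := by
      rw [hfc, ← map_ratCast_mul₄₅, ← hcf, map_ratCast_mul₄₅]
    have ccx : c.map ((↑) : ℚ → ℂ) * x = x * c.map ((↑) : ℚ → ℂ) := by rw [hx, comm_smul_add₄₅ cch cce ccf]
    rw [mem_endAlgRat_iff_map_ratCast_complex₄₅, ← hJc']
    calc c.map ((↑) : ℚ → ℂ) * Jc = (c * (h * h)).map ((↑) : ℚ → ℂ) * Jc := by rw [hcP]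
      _ = c.map ((↑) : ℚ → ℂ) * (hc * hc * Jc) := by
        rw [map_ratCast_mul₄₅, map_ratCast_mul₄₅, ← hhc, Matrix.mul_assoc]
      _ = Jc * (hc * hc) * c.map ((↑) : ℚ → ℂ) := by rw [hPJ, ccx, hJP]
      _ = Jc * (h * h * c).map ((↑) : ℚ → ℂ) := by
        rw [map_ratCast_mul₄₅, map_ratCast_mul₄₅, ← hhc, Matrix.mul_assoc]
      _ = Jc * c.map ((↑) : ℚ → ℂ) := by rw [hPc]

end ComplexPart

/-! ### §3 «`J₂` acts trivially»: the kernel `𝔤₁` kills `Im h²` -/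

section RationalPart

variable {ι₁ : Type*} [Fintype ι₁] [DecidableEq ι₁] {E₁ : Type*} [NormedAddCommGroup E₁] [NormedSpace ℂ E₁]
  {Φ₁ : (ι₁ → ℝ) ≃L[ℝ] E₁} {η₁ : E₁ [⋀^Fin 2]→L[ℝ] ℝ} {h e f : Matrix ι₁ ι₁ ℚ}

/-- **«We conclude that `J₂` acts trivially»**, rationally: an `A ∈ 𝒜(X)` commuting with the standard-isotypic triple
`(h, e, f)` satisfies `A h² = 0`.  Every `c = Q C₀ Q + f Q C₀ Q e` (`Q = e f`) lies in the commutant `𝒞 ⊆ End⁰(X)` of `𝔰`,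
so commutes with `A` (Lange 7.2.5 over `ℚ`); matrix units then make `A Q = λ Q`, `A h² = λ h²`, and `𝒜(X) ⊆ 𝔰𝔭(V, E)`
(`ᵗA G = -G A`, `ᵗ(h²) G = G h²`) forces `λ = 0`.  (Replaces the passage through a simple abelian subvariety in the printed
proof of Lemma (3.4).) [cite: MoonenZarhin1999LowDim, §3 Lemma (3.3)–(3.4) (proof) and §1 ("`Hg(X) ⊂ Sp_D(V, φ)`")]
[cite: Lange2023AbelianVarietiesComplex, §7.2.2 Prop. 7.2.5 and §7.2.4 Exercise (3)] -/
private theorem IsRiemannForm.mul_sq_eq_zero_of_comm₄₅ (hη₁ : IsRiemannForm Φ₁ η₁) (hh : h ∈ hodgeGroupLieRat Φ₁)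
    (h0 : h ≠ 0) (ee : e * e = 0) (ff : f * f = 0) (hhe : h * e = e) (heh : e * h = -e) (hhf : h * f = -f)
    (hfh : f * h = f) (hef : e * f + f * e = h * h) (hhh : h * h * h = h)
    (hC : ∀ c : Matrix ι₁ ι₁ ℚ, h * h * c = c → h * c = c * h → e * c = c * e → f * c = c * f → c ∈ endAlgRat Φ₁)
    {A : Matrix ι₁ ι₁ ℚ} (hA : A ∈ hodgeGroupLieRat Φ₁) (cAh : A * h = h * A) (cAe : A * e = e * A)
    (cAf : A * f = f * A) : A * (h * h) = 0 := by
  -- the projector `Q = e f` and its companions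
  have hfe : f * e = h * h - e * f := eq_sub_of_add_eq' hef
  have efe : e * f * e = e := by
    rw [mul_assoc, hfe, mul_sub, ← mul_assoc, ← mul_assoc, heh, neg_mul, heh, neg_neg, ee, zero_mul, sub_zero]
  have fef : f * e * f = f := by
    rw [hfe, sub_mul, mul_assoc, hhf, mul_neg, hhf, neg_neg, mul_assoc, ff, mul_zero, sub_zero]
  have Pf : h * h * f = f := by rw [mul_assoc, hhf, mul_neg, hhf, neg_neg]
  obtain ⟨Q, hQ⟩ : ∃ Q, Q = e * f := ⟨_, rfl⟩
  have QQ : Q * Q = Q := by rw [hQ, ← mul_assoc, efe]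
  have hQl : h * Q = Q := by rw [hQ, ← mul_assoc, hhe]
  have Qh : Q * h = Q := by rw [hQ, mul_assoc, hfh]
  have eQ : e * Q = 0 := by rw [hQ, ← mul_assoc, ee, zero_mul]
  have Qf : Q * f = 0 := by rw [hQ, mul_assoc, ff, mul_zero]
  have fQe : f * Q * e = f * e := by rw [hQ, ← mul_assoc, fef]
  have AQ : A * Q = Q * A := by rw [hQ, ← mul_assoc, cAe, mul_assoc, cAf, ← mul_assoc]
  have Q0 : Q ≠ 0 := by
    intro hQ0
    have he0 : e = 0 := by rw [← efe, ← hQ, hQ0, zero_mul]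
    exact h0 (by rw [← hhh, ← hef, he0, zero_mul, mul_zero, add_zero, zero_mul])
  -- `A Q C₀ Q = Q C₀ Q A` through `c = Q C₀ Q + f Q C₀ Q e ∈ 𝒞 ⊆ End⁰(X)`
  have key : ∀ C₀ : Matrix ι₁ ι₁ ℚ, A * (Q * C₀ * Q) = Q * C₀ * Q * A := by
    intro C₀
    obtain ⟨M, hM⟩ : ∃ M, M = Q * C₀ * Q := ⟨_, rfl⟩
    rw [← hM]
    have hMl : h * M = M := by rw [hM, ← mul_assoc, ← mul_assoc, hQl]
    have hMr : M * h = M := by rw [hM, mul_assoc (Q * C₀) Q h, Qh]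
    have eM : e * M = 0 := by rw [hM, ← mul_assoc, ← mul_assoc, eQ, zero_mul, zero_mul]
    have QM : Q * M = M := by rw [hM, ← mul_assoc, ← mul_assoc, QQ]
    have Mf : M * f = 0 := by rw [hM, mul_assoc (Q * C₀) Q f, Qf, mul_zero]
    have MQ : M * Q = M := by rw [hM, mul_assoc (Q * C₀) Q Q, QQ]
    have QfMe : Q * (f * M * e) = 0 := by rw [← mul_assoc, ← mul_assoc, Qf, zero_mul, zero_mul]
    have h1 : h * h * (M + f * M * e) = M + f * M * e := by
      rw [mul_add, mul_assoc h h M, hMl, hMl, ← mul_assoc (h * h) (f * M) e, ← mul_assoc (h * h) f M, Pf]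
    have h2 : h * (M + f * M * e) = (M + f * M * e) * h := by
      rw [mul_add, add_mul, hMl, hMr, ← mul_assoc h (f * M) e, ← mul_assoc h f M, hhf, mul_assoc (f * M) e h, heh,
        neg_mul, neg_mul, mul_neg]
    have h3 : e * (M + f * M * e) = (M + f * M * e) * e := by
      rw [mul_add, add_mul, eM, zero_add, ← mul_assoc e (f * M) e, ← mul_assoc e f M, ← hQ, QM, mul_assoc (f * M) e e,
        ee, mul_zero, add_zero]
    have h4 : f * (M + f * M * e) = (M + f * M * e) * f := by
      rw [mul_add, add_mul, ← mul_assoc f (f * M) e, ← mul_assoc f f M, ff, zero_mul, zero_mul, add_zero, Mf, zero_add,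
        mul_assoc (f * M) e f, ← hQ, mul_assoc f M Q, MQ]
    have hcomm := mul_comm_of_mem_hodgeGroupLieRat_of_mem_endAlgRat hA (hC _ h1 h2 h3 h4)
    have l1 : Q * (A * (M + f * M * e)) = A * M := by
      rw [← mul_assoc, ← AQ, mul_assoc, mul_add, QM, QfMe, add_zero]
    have l2 : Q * ((M + f * M * e) * A) = M * A := by rw [← mul_assoc, mul_add, QM, QfMe, add_zero]
    rw [← l1, hcomm, l2]
  -- matrix units: `A Q = λ Q`, hence `A h² = λ h²`
  obtain ⟨t, ht⟩ := exists_mul_eq_smul_of_forall_single₄₅ Q0 fun k l ↦ key (Matrix.single k l 1)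
  have hAP : A * (h * h) = t • (h * h) := by
    rw [← hef, ← hQ, ← fQe, mul_add, ht, ← mul_assoc A (f * Q) e, ← mul_assoc A f Q, cAf, mul_assoc f A Q, ht,
      mul_smul_comm, smul_mul_assoc, smul_add]
  -- symplectic: `ᵗ(A h²) G = λ G h² = -λ G h²`
  obtain ⟨G, hG⟩ := hη₁.exists_ratMatrix_latticeGram
  have hdet : IsUnit G.det := isUnit_det_of_map_ratCast hG hη₁.isUnit_det_latticeGram
  have hT := hη₁.transpose_mul_eq_neg_mul_of_mem_hodgeGroupLieRat hG hh
  have AT := hη₁.transpose_mul_eq_neg_mul_of_mem_hodgeGroupLieRat hG hA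
  have PT : (h * h)ᵀ * G = G * (h * h) := by
    rw [Matrix.transpose_mul, Matrix.mul_assoc, hT, Matrix.mul_neg, ← Matrix.mul_assoc, hT, Matrix.neg_mul, neg_neg,
      Matrix.mul_assoc]
  have PA : h * h * A = A * (h * h) := by rw [mul_assoc, ← cAh, ← mul_assoc, ← cAh, mul_assoc]
  have e1 : (A * (h * h))ᵀ * G = -(t • (G * (h * h))) := by
    rw [Matrix.transpose_mul, Matrix.mul_assoc, AT, Matrix.mul_neg, ← Matrix.mul_assoc, PT, Matrix.mul_assoc, PA, hAP,
      Matrix.mul_smul]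
  have e2 : (A * (h * h))ᵀ * G = t • (G * (h * h)) := by rw [hAP, Matrix.transpose_smul, Matrix.smul_mul, PT]
  have e3 : (t + t) • (G * (h * h)) = 0 := by
    rw [add_smul]
    nth_rewrite 1 [← e2]
    rw [e1, neg_add_cancel]
  rcases eq_or_ne t 0 with ht0 | ht0
  · rw [hAP, ht0, zero_smul]
  · exfalso
    have hGP : G * (h * h) = 0 := (smul_eq_zero.1 e3).resolve_left (by rwa [add_self_eq_zero])
    have hP0 : h * h = 0 := by
      have e4 : G⁻¹ * (G * (h * h)) = 0 := by rw [hGP, Matrix.mul_zero]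
      rwa [← Matrix.mul_assoc, Matrix.nonsing_inv_mul G hdet, Matrix.one_mul] at e4
    exact h0 (by rw [← hhh, hP0, zero_mul])

end RationalPart

/-! ### §4 «some multiple of `φ` corresponds to an isogeny»: `Hom(E_τ, X) ≠ 0`, and Proposition (3.8) -/

section Main

variable {ι₁ : Type*} [Fintype ι₁] [DecidableEq ι₁] {E₁ : Type*} [NormedAddCommGroup E₁] [NormedSpace ℂ E₁]
  {Φ₁ : (ι₁ → ℝ) ≃L[ℝ] E₁} {η₁ : E₁ [⋀^Fin 2]→L[ℝ] ℝ} {τ : ℂ} (hτ : τ.im ≠ 0)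

/-- **MOONEN–ZARHIN, LEMMA (3.4)/(3.8) FOR A NON-CM ELLIPTIC CURVE: `Hg(X × E)(ℂ) ≠ Hg(X)(ℂ) × Hg(E)(ℂ)` ⟹ `Hom(E, X) ≠ 0`.**
For `X = E₁/Φ₁(ℤ^{ι₁})` polarised and `E = E_τ` with `End(E_τ) = ℤ`: if the Hodge group of `X × E_τ` is not the product,
then `Hom_ℚ(E_τ, X) ≠ 0` («the graph `Γ_φ` … some multiple of `φ` corresponds to an isogeny»: here the `|ι₁| × 2` matrix
`[e f u | f e f u]` built from the standard-isotypic triple intertwines `𝒜(X × E_τ)`).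
[cite: MoonenZarhin1999LowDim, §3 Lemma (3.3), Lemma (3.4) and Prop. (3.8) (p0006 L84–p0007 L74)]
[cite: Lange2023AbelianVarietiesComplex, §7.2.4 Exercise (3)] -/
theorem IsRiemannForm.homRat_ellipticPeriod_ne_bot_of_hodgeGroupC_prod_ne (hη₁ : IsRiemannForm Φ₁ η₁)
    (hE : ellipticEnd hτ = ⊥)
    (hne : hodgeGroupC (prodPeriod Φ₁ (ellipticPeriod hτ)) ≠
      blockDiagProd (hodgeGroupC Φ₁) (hodgeGroupC (ellipticPeriod hτ))) :
    homRat (ellipticPeriod hτ) Φ₁ ≠ ⊥ := by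
  obtain ⟨h, e, f, hh, -, -, h0, rhe, rhf, ref, hK, hdecA, hgraph⟩ :=
    hη₁.exists_sl2Triple_hodgeGroupLieRat_of_hodgeGroupC_prod_ellipticPeriod_ne hτ hE hne
  obtain ⟨JI, α, β, γ, cJh, cJe, cJf, hJc⟩ := exists_jMatrix_map_eq_add₄₅ hK hdecA
  obtain ⟨ee, ff, hhe, heh, hhf, hfh, hef, hhh, hC⟩ := sl2Triple_identities₄₅ hh h0 rhe rhf ref cJh cJe cJf hJc
  -- §3: the kernel kills `Im h²`
  have hker : ∀ A ∈ hodgeGroupLieRat Φ₁,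
      Matrix.fromBlocks A 0 0 (0 : Matrix (Fin 2) (Fin 2) ℚ) ∈ hodgeGroupLieRat (prodPeriod Φ₁ (ellipticPeriod hτ)) →
        A * (h * h) = 0 := by
    intro A hA hA0
    obtain ⟨cAh, cAe, cAf⟩ := hK A hA hA0
    exact hη₁.mul_sq_eq_zero_of_comm₄₅ hh h0 ee ff hhe heh hhf hfh hef hhh hC hA cAh cAe cAf
  -- the projector `Q = e f ≠ 0` and a non-zero column `j`
  obtain ⟨Q, hQ⟩ : ∃ Q, Q = e * f := ⟨_, rfl⟩
  have efe : e * f * e = e := by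
    rw [mul_assoc, (eq_sub_of_add_eq' hef : f * e = h * h - e * f), mul_sub, ← mul_assoc, ← mul_assoc, heh, neg_mul, heh,
      neg_neg, ee, zero_mul, sub_zero]
  have QQ : Q * Q = Q := by rw [hQ, ← mul_assoc, efe]
  have hQl : h * Q = Q := by rw [hQ, ← mul_assoc, hhe]
  have eQ : e * Q = 0 := by rw [hQ, ← mul_assoc, ee, zero_mul]
  have PQ : h * h * Q = Q := by rw [mul_assoc, hQl, hQl]
  have Pf : h * h * f = f := by rw [mul_assoc, hhf, mul_neg, hhf, neg_neg]
  have hfQ : h * (f * Q) = -(f * Q) := by rw [← mul_assoc, hhf, neg_mul]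
  have efQ : e * (f * Q) = Q := by rw [← mul_assoc, ← hQ, QQ]
  have ffQ : f * (f * Q) = 0 := by rw [← mul_assoc, ff, zero_mul]
  have Q0 : Q ≠ 0 := by
    intro hQ0
    have he0 : e = 0 := by rw [← efe, ← hQ, hQ0, zero_mul]
    exact h0 (by rw [← hhh, ← hef, he0, zero_mul, mul_zero, add_zero, zero_mul])
  obtain ⟨i, j, hij⟩ : ∃ i j, Q i j ≠ 0 := by
    by_contra hall
    exact Q0 (Matrix.ext fun i j ↦ by
      have h1 := not_exists.1 hall i
      rw [not_exists] at h1
      simpa using h1 j)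
  -- `F = [Q u | f Q u]`, `u = e_j`
  obtain ⟨F, hF⟩ : ∃ F : Matrix ι₁ (Fin 2) ℚ, F = Matrix.of fun k s ↦ if s = 0 then Q k j else (f * Q) k j := ⟨_, rfl⟩
  have hF0 : ∀ k, F k 0 = Q k j := fun k ↦ by rw [hF, Matrix.of_apply, if_pos rfl]
  have hF1 : ∀ k, F k 1 = (f * Q) k j := fun k ↦ by rw [hF, Matrix.of_apply, if_neg one_ne_zero]
  have hFmem : F ∈ homRat (ellipticPeriod hτ) Φ₁ := by
    refine (mem_homRat_iff_forall_mul_toBlocks₂₂_eq_toBlocks₁₁_mul Φ₁ (ellipticPeriod hτ)).2 fun C hC ↦ ?_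
    obtain ⟨A₀, hA₀, a, b, c, hA₀P, h11, h22⟩ := hgraph C hC
    have hA₀Q : A₀ * Q = 0 := by rw [← PQ, ← mul_assoc A₀ (h * h) Q, hker A₀ hA₀ hA₀P, zero_mul]
    have hA₀fQ : A₀ * (f * Q) = 0 := by
      rw [← Pf, ← mul_assoc, ← mul_assoc A₀ (h * h) f, hker A₀ hA₀ hA₀P, zero_mul, zero_mul]
    have C11Q : C.toBlocks₁₁ * Q = a • Q + c • (f * Q) := by
      rw [h11, add_mul, add_mul, add_mul, smul_mul_assoc, smul_mul_assoc, smul_mul_assoc, hA₀Q, hQl, eQ, zero_add,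
        smul_zero, add_zero]
    have C11fQ : C.toBlocks₁₁ * (f * Q) = b • Q + (-a) • (f * Q) := by
      rw [h11, add_mul, add_mul, add_mul, smul_mul_assoc, smul_mul_assoc, smul_mul_assoc, hA₀fQ, hfQ, efQ, ffQ, zero_add,
        smul_zero, add_zero, smul_neg, neg_smul, add_comm]
    have W00 : C.toBlocks₂₂ 0 0 = a := by rw [h22]; simp
    have W01 : C.toBlocks₂₂ 0 1 = b := by rw [h22]; simp
    have W10 : C.toBlocks₂₂ 1 0 = c := by rw [h22]; simp
    have W11 : C.toBlocks₂₂ 1 1 = -a := by rw [h22]; simp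
    have R0 : ∀ k, (C.toBlocks₁₁ * F) k 0 = (C.toBlocks₁₁ * Q) k j := fun k ↦ by simp only [Matrix.mul_apply, hF0]
    have R1 : ∀ k, (C.toBlocks₁₁ * F) k 1 = (C.toBlocks₁₁ * (f * Q)) k j := fun k ↦ by simp only [Matrix.mul_apply, hF1]
    ext k s
    fin_cases s
    · show (F * C.toBlocks₂₂) k 0 = (C.toBlocks₁₁ * F) k 0
      rw [R0, C11Q, Matrix.mul_apply, Fin.sum_univ_two, hF0, hF1, W00, W10, Matrix.add_apply, Matrix.smul_apply,
        Matrix.smul_apply, smul_eq_mul, smul_eq_mul]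
      ring
    · show (F * C.toBlocks₂₂) k 1 = (C.toBlocks₁₁ * F) k 1
      rw [R1, C11fQ, Matrix.mul_apply, Fin.sum_univ_two, hF0, hF1, W01, W11, Matrix.add_apply, Matrix.smul_apply,
        Matrix.smul_apply, smul_eq_mul, smul_eq_mul]
      ring
  have hF0' : F ≠ 0 := fun hF0' ↦ hij (by rw [← hF0 i, hF0', Matrix.zero_apply])
  exact (Submodule.ne_bot_iff _).2 ⟨F, hFmem, hF0'⟩

/-- **MOONEN–ZARHIN, PROPOSITION (3.8) WITH `End(E) = ℤ`: `Hom(E, X) = 0` ⟹ `Hg(X × E)(ℂ) = Hg(X)(ℂ) × Hg(E)(ℂ)`** (complex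
points; `X` polarised, `E = E_τ` without complex multiplication: «If `End⁰(E) = ℚ` then we apply Lemma (3.4)»).
[cite: MoonenZarhin1999LowDim, §3 Prop. (3.8) (p0007 L55–L65) and Lemma (3.4)] -/
theorem IsRiemannForm.hodgeGroupC_prod_ellipticPeriod_eq_blockDiagProd_of_homRat_eq_bot (hη₁ : IsRiemannForm Φ₁ η₁)
    (hE : ellipticEnd hτ = ⊥) (hHom : homRat (ellipticPeriod hτ) Φ₁ = ⊥) :
    hodgeGroupC (prodPeriod Φ₁ (ellipticPeriod hτ)) = blockDiagProd (hodgeGroupC Φ₁) (hodgeGroupC (ellipticPeriod hτ)) := by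
  by_contra hne
  exact hη₁.homRat_ellipticPeriod_ne_bot_of_hodgeGroupC_prod_ne hτ hE hne hHom

/-- The same on REAL POINTS: `Hg(X × E)(ℝ) = Hg(X)(ℝ) × Hg(E)(ℝ)` for `X` polarised, `End(E_τ) = ℤ`, `Hom(E_τ, X) = 0`.
[cite: MoonenZarhin1999LowDim, §3 Prop. (3.8) and (3.1)] [cite: Imai1976HodgeGroups, §2] -/
theorem IsRiemannForm.hodgeGroup_prod_ellipticPeriod_eq_of_homRat_eq_bot (hη₁ : IsRiemannForm Φ₁ η₁)
    (hE : ellipticEnd hτ = ⊥) (hHom : homRat (ellipticPeriod hτ) Φ₁ = ⊥) :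
    hodgeGroup (prodPeriod Φ₁ (ellipticPeriod hτ)) =
      ((hodgeGroup Φ₁).prod (hodgeGroup (ellipticPeriod hτ))).map (blockDiag ι₁ (Fin 2)) :=
  hodgeGroup_prod_eq_of_hodgeGroupC_prod_eq (hη₁.hodgeGroupC_prod_ellipticPeriod_eq_blockDiagProd_of_homRat_eq_bot hτ hE hHom)

/-- **The same for an abelian variety `X`** (some polarisation): `End(E_τ) = ℤ`, `Hom(E_τ, X) = 0` ⟹
`Hg(X × E_τ)(ℂ) = Hg(X)(ℂ) × Hg(E_τ)(ℂ)`. [cite: MoonenZarhin1999LowDim, §3 Prop. (3.8) (p0007 L55–L65)] -/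
theorem IsAbelianVariety.hodgeGroupC_prod_ellipticPeriod_eq_blockDiagProd_of_homRat_eq_bot (hX : IsAbelianVariety Φ₁)
    (hE : ellipticEnd hτ = ⊥) (hHom : homRat (ellipticPeriod hτ) Φ₁ = ⊥) :
    hodgeGroupC (prodPeriod Φ₁ (ellipticPeriod hτ)) = blockDiagProd (hodgeGroupC Φ₁) (hodgeGroupC (ellipticPeriod hτ)) := by
  obtain ⟨η₁, hη₁⟩ := hX
  exact hη₁.hodgeGroupC_prod_ellipticPeriod_eq_blockDiagProd_of_homRat_eq_bot hτ hE hHom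

/-- **For an abelian variety `X` and a non-CM `E_τ`: `Hg(X × E_τ)(ℂ) ≠ Hg(X)(ℂ) × Hg(E_τ)(ℂ)` ⟹ `Hom_ℚ(E_τ, X) ≠ 0`.**
[cite: MoonenZarhin1999LowDim, §3 Lemma (3.4) and Prop. (3.8)] -/
theorem IsAbelianVariety.homRat_ellipticPeriod_ne_bot_of_hodgeGroupC_prod_ne (hX : IsAbelianVariety Φ₁)
    (hE : ellipticEnd hτ = ⊥)
    (hne : hodgeGroupC (prodPeriod Φ₁ (ellipticPeriod hτ)) ≠
      blockDiagProd (hodgeGroupC Φ₁) (hodgeGroupC (ellipticPeriod hτ))) :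
    homRat (ellipticPeriod hτ) Φ₁ ≠ ⊥ := by
  obtain ⟨η₁, hη₁⟩ := hX
  exact hη₁.homRat_ellipticPeriod_ne_bot_of_hodgeGroupC_prod_ne hτ hE hne

/-- **MOONEN–ZARHIN, PROPOSITION (3.8) AS PRINTED (both halves).**  «Let `X` be an abelian variety and let `E` be an
elliptic curve, both over `ℂ`.  Suppose `Hom(E, X) = 0`.  Then either `Hg(X × E) = Hg(X) × Hg(E)` or `End⁰(E) = k` is an
imaginary quadratic field such that there exists an embedding of `k` into the center of `End⁰(X)`.»  Here on complex points,
for `X = E₁/Φ₁(ℤ^{ι₁})` polarised and `E = E_τ`; the second alternative in the tree's g44 form: `E_τ` has CM and `k = ℚ(τ)`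
lies in the image of an eigencharacter `χ` of the centre of `End⁰(X)` on `H₁(X, ℂ)` (the non-CM case is this file's §4,
the CM case `IsRiemannForm.exists_eigencharacter_center_endAlgRat_of_hodgeGroupC_prod_ellipticPeriod_ne`).
[cite: MoonenZarhin1999LowDim, §3 Prop. (3.8) (p0007 L55–L74)] -/
theorem IsRiemannForm.hodgeGroupC_prod_ellipticPeriod_eq_blockDiagProd_or_of_homRat_eq_bot (hη₁ : IsRiemannForm Φ₁ η₁)
    (hHom : homRat (ellipticPeriod hτ) Φ₁ = ⊥) :
    hodgeGroupC (prodPeriod Φ₁ (ellipticPeriod hτ)) = blockDiagProd (hodgeGroupC Φ₁) (hodgeGroupC (ellipticPeriod hτ)) ∨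
      (ellipticEnd hτ ≠ ⊥ ∧ ∃ y : ι₁ → ℂ, y ≠ 0 ∧ ∃ χ : Subalgebra.center ℚ (endAlgRat Φ₁) →ₐ[ℚ] ℂ,
        (∀ c : Subalgebra.center ℚ (endAlgRat Φ₁),
          ((c : endAlgRat Φ₁) : Matrix ι₁ ι₁ ℚ).map ((↑) : ℚ → ℂ) *ᵥ y = χ c • y) ∧ τ ∈ χ.range) := by
  by_cases hsplit : hodgeGroupC (prodPeriod Φ₁ (ellipticPeriod hτ)) =
      blockDiagProd (hodgeGroupC Φ₁) (hodgeGroupC (ellipticPeriod hτ))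
  · exact Or.inl hsplit
  · have hCM : ellipticEnd hτ ≠ ⊥ := fun hE ↦
      hsplit (hη₁.hodgeGroupC_prod_ellipticPeriod_eq_blockDiagProd_of_homRat_eq_bot hτ hE hHom)
    exact Or.inr ⟨hCM, hη₁.exists_eigencharacter_center_endAlgRat_of_hodgeGroupC_prod_ellipticPeriod_ne hτ hCM hsplit⟩

/-- Proposition (3.8) as printed, for an abelian variety `X` (some polarisation).
[cite: MoonenZarhin1999LowDim, §3 Prop. (3.8) (p0007 L55–L74)] -/
theorem IsAbelianVariety.hodgeGroupC_prod_ellipticPeriod_eq_blockDiagProd_or_of_homRat_eq_bot (hX : IsAbelianVariety Φ₁)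
    (hHom : homRat (ellipticPeriod hτ) Φ₁ = ⊥) :
    hodgeGroupC (prodPeriod Φ₁ (ellipticPeriod hτ)) = blockDiagProd (hodgeGroupC Φ₁) (hodgeGroupC (ellipticPeriod hτ)) ∨
      (ellipticEnd hτ ≠ ⊥ ∧ ∃ y : ι₁ → ℂ, y ≠ 0 ∧ ∃ χ : Subalgebra.center ℚ (endAlgRat Φ₁) →ₐ[ℚ] ℂ,
        (∀ c : Subalgebra.center ℚ (endAlgRat Φ₁),
          ((c : endAlgRat Φ₁) : Matrix ι₁ ι₁ ℚ).map ((↑) : ℚ → ℂ) *ᵥ y = χ c • y) ∧ τ ∈ χ.range) := by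
  obtain ⟨η₁, hη₁⟩ := hX
  exact hη₁.hodgeGroupC_prod_ellipticPeriod_eq_blockDiagProd_or_of_homRat_eq_bot hτ hHom

end Main

/-! ### §5 The dichotomy for a non-CM elliptic factor: `Hg(X × E_τ) = Hg(X) × Hg(E_τ)` ⟺ `Hom(E_τ, X) = 0` -/

section Dichotomy

variable {ι₁ ι₂ : Type*} [Fintype ι₁] [DecidableEq ι₁] [Fintype ι₂] [DecidableEq ι₂] {E₁ E₂ : Type*}
  [NormedAddCommGroup E₁] [NormedSpace ℂ E₁] [NormedAddCommGroup E₂] [NormedSpace ℂ E₂]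
  {Φ₁ : (ι₁ → ℝ) ≃L[ℝ] E₁} {Φ₂ : (ι₂ → ℝ) ≃L[ℝ] E₂} {η₁ : E₁ [⋀^Fin 2]→L[ℝ] ℝ} {τ : ℂ} (hτ : τ.im ≠ 0)

omit hτ in
/-- `Hom_ℚ(X₁, X₂) = 0 ⟺ Hom_ℚ(X₂, X₁) = 0` for abelian varieties (`rk Hom(X₁, X₂) = rk Hom(X₂, X₁)`).
[cite: HulekLaface2019PicardNumbersAV, §2.1 Prop. 2.2 (proof)] -/
theorem IsAbelianVariety.homRat_eq_bot_comm (h₁ : IsAbelianVariety Φ₁) (h₂ : IsAbelianVariety Φ₂) :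
    homRat Φ₁ Φ₂ = ⊥ ↔ homRat Φ₂ Φ₁ = ⊥ := by
  rw [← Submodule.finrank_eq_zero, ← Submodule.finrank_eq_zero, finrank_homRat_comm_of_isAbelianVariety h₁ h₂]

/-- **THE DICHOTOMY FOR A NON-CM ELLIPTIC FACTOR (complex points): for `X` polarised and `End(E_τ) = ℤ`,
`Hg(X × E_τ)(ℂ) = Hg(X)(ℂ) × Hg(E_τ)(ℂ)` ⟺ `Hom_ℚ(E_τ, X) = 0`** — «⟸» is Proposition (3.8) (§4); «⟹» holds for any two
tori («We may have that `Hg(X₁ × X₂) ≠ Hg(X₁) × Hg(X₂)`, e.g. if `Hom(X₁, X₂) ≠ 0`», the tree's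
`homRat_swap_eq_bot_of_hodgeGroup_prodPeriod_eq_map_blockDiag`).
[cite: MoonenZarhin1999LowDim, §3 (3.1) (p0006 L53–L60), Lemma (3.4) and Prop. (3.8)] [cite: Imai1976HodgeGroups, §3 Remarks (p. 370)] -/
theorem IsRiemannForm.hodgeGroupC_prod_ellipticPeriod_eq_blockDiagProd_iff_homRat_eq_bot (hη₁ : IsRiemannForm Φ₁ η₁)
    (hE : ellipticEnd hτ = ⊥) :
    hodgeGroupC (prodPeriod Φ₁ (ellipticPeriod hτ)) = blockDiagProd (hodgeGroupC Φ₁) (hodgeGroupC (ellipticPeriod hτ)) ↔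
      homRat (ellipticPeriod hτ) Φ₁ = ⊥ :=
  ⟨fun h ↦ homRat_swap_eq_bot_of_hodgeGroup_prodPeriod_eq_map_blockDiag Φ₁ (ellipticPeriod hτ)
      (hodgeGroup_prod_eq_of_hodgeGroupC_prod_eq h),
    hη₁.hodgeGroupC_prod_ellipticPeriod_eq_blockDiagProd_of_homRat_eq_bot hτ hE⟩

/-- The dichotomy on REAL POINTS: `Hg(X × E_τ)(ℝ) = Hg(X)(ℝ) × Hg(E_τ)(ℝ)` ⟺ `Hom_ℚ(E_τ, X) = 0` (`X` polarised,
`End(E_τ) = ℤ`). [cite: MoonenZarhin1999LowDim, §3 (3.1), Lemma (3.4) and Prop. (3.8)] [cite: Imai1976HodgeGroups, §2–§3] -/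
theorem IsRiemannForm.hodgeGroup_prod_ellipticPeriod_eq_iff_homRat_eq_bot (hη₁ : IsRiemannForm Φ₁ η₁)
    (hE : ellipticEnd hτ = ⊥) :
    hodgeGroup (prodPeriod Φ₁ (ellipticPeriod hτ)) =
        ((hodgeGroup Φ₁).prod (hodgeGroup (ellipticPeriod hτ))).map (blockDiag ι₁ (Fin 2)) ↔
      homRat (ellipticPeriod hτ) Φ₁ = ⊥ :=
  ⟨homRat_swap_eq_bot_of_hodgeGroup_prodPeriod_eq_map_blockDiag Φ₁ (ellipticPeriod hτ),
    hη₁.hodgeGroup_prod_ellipticPeriod_eq_of_homRat_eq_bot hτ hE⟩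

/-- The dichotomy with `Hom_ℚ(X, E_τ)` (the order of the factors in `Hom` is immaterial for abelian varieties):
`Hg(X × E_τ)(ℂ) = Hg(X)(ℂ) × Hg(E_τ)(ℂ)` ⟺ `Hom_ℚ(X, E_τ) = 0`. [cite: MoonenZarhin1999LowDim, §3 (3.1), Lemma (3.4) and Prop. (3.8)]
[cite: HulekLaface2019PicardNumbersAV, §2.1 Prop. 2.2] -/
theorem IsRiemannForm.hodgeGroupC_prod_ellipticPeriod_eq_blockDiagProd_iff_homRat_swap_eq_bot
    (hη₁ : IsRiemannForm Φ₁ η₁) (hE : ellipticEnd hτ = ⊥) :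
    hodgeGroupC (prodPeriod Φ₁ (ellipticPeriod hτ)) = blockDiagProd (hodgeGroupC Φ₁) (hodgeGroupC (ellipticPeriod hτ)) ↔
      homRat Φ₁ (ellipticPeriod hτ) = ⊥ := by
  rw [hη₁.hodgeGroupC_prod_ellipticPeriod_eq_blockDiagProd_iff_homRat_eq_bot hτ hE,
    IsAbelianVariety.homRat_eq_bot_comm (isAbelianVariety_ellipticPeriod hτ) ⟨η₁, hη₁⟩]

/-- **Non-split ⟺ `Hom_ℚ(E_τ, X) ≠ 0`** for `X` polarised and `End(E_τ) = ℤ`.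
[cite: MoonenZarhin1999LowDim, §3 (3.1), Lemma (3.4) and Prop. (3.8)] -/
theorem IsRiemannForm.hodgeGroupC_prod_ellipticPeriod_ne_blockDiagProd_iff_homRat_ne_bot (hη₁ : IsRiemannForm Φ₁ η₁)
    (hE : ellipticEnd hτ = ⊥) :
    hodgeGroupC (prodPeriod Φ₁ (ellipticPeriod hτ)) ≠ blockDiagProd (hodgeGroupC Φ₁) (hodgeGroupC (ellipticPeriod hτ)) ↔
      homRat (ellipticPeriod hτ) Φ₁ ≠ ⊥ :=
  (hη₁.hodgeGroupC_prod_ellipticPeriod_eq_blockDiagProd_iff_homRat_eq_bot hτ hE).not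

/-- The dichotomy for an abelian variety `X` (some polarisation) and a non-CM `E_τ`:
`Hg(X × E_τ)(ℂ) = Hg(X)(ℂ) × Hg(E_τ)(ℂ)` ⟺ `Hom_ℚ(E_τ, X) = 0`. [cite: MoonenZarhin1999LowDim, §3 (3.1), Lemma (3.4) and Prop. (3.8)] -/
theorem IsAbelianVariety.hodgeGroupC_prod_ellipticPeriod_eq_blockDiagProd_iff_homRat_eq_bot (hX : IsAbelianVariety Φ₁)
    (hE : ellipticEnd hτ = ⊥) :
    hodgeGroupC (prodPeriod Φ₁ (ellipticPeriod hτ)) = blockDiagProd (hodgeGroupC Φ₁) (hodgeGroupC (ellipticPeriod hτ)) ↔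
      homRat (ellipticPeriod hτ) Φ₁ = ⊥ := by
  obtain ⟨η₁, hη₁⟩ := hX
  exact hη₁.hodgeGroupC_prod_ellipticPeriod_eq_blockDiagProd_iff_homRat_eq_bot hτ hE

/-- … and on real points, for an abelian variety `X`. [cite: MoonenZarhin1999LowDim, §3 (3.1), Lemma (3.4) and Prop. (3.8)] -/
theorem IsAbelianVariety.hodgeGroup_prod_ellipticPeriod_eq_iff_homRat_eq_bot (hX : IsAbelianVariety Φ₁)
    (hE : ellipticEnd hτ = ⊥) :
    hodgeGroup (prodPeriod Φ₁ (ellipticPeriod hτ)) =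
        ((hodgeGroup Φ₁).prod (hodgeGroup (ellipticPeriod hτ))).map (blockDiag ι₁ (Fin 2)) ↔
      homRat (ellipticPeriod hτ) Φ₁ = ⊥ := by
  obtain ⟨η₁, hη₁⟩ := hX
  exact hη₁.hodgeGroup_prod_ellipticPeriod_eq_iff_homRat_eq_bot hτ hE

end Dichotomy

end ComplexTorus

end Literature.Geometry.Kaehler
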